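import Literature.Barriers.CriticalPhenomena.LaceExpansionXSpaceChains
import HarnessLib

/-!
# Weighted lines and the piece estimates of Hara's weighted `N`-loop bound (Hara 2008, §3.4,
# Step 2) on the Hara–Slade diagrams at `p_c` — PROVED

Barrier catalogue `Literature/Barriers/CriticalPhenomena/` (D-0021). Fourth layer under
`Hara2008_weightedNLoopBoundPc` (`LaceExpansionXSpaceLemma16.lean`): after the diagrams were written as
chains of pair kernels (`LaceExpansionXSpaceChains.lean`) and the norms `‖·‖_{∞→∞}`, `‖·‖_{1→1}`,
`‖·‖_mix` with the three-factor estimate were set up (`LaceExpansionXSpaceKernelNorms.lean`), this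
file supplies the estimates of the individual PIECES that Hara's Step 2 peels off ("We can peel off
(open) triangles from left and right, leaving `|x|^β`-, `|x|^γ`-weighted parts in the middle"; cases
(b-2): `W^{(β,γ)}`, (b-3): `W̄^{(β,0)}` and "a triangle and `T^{(0,γ)}`"), in terms of Hara's suprema
`W̄^{(b,c)}`, `T̄^{(b,c)}` (`LaceExpansionXSpaceNorms.lean`) and the triangles `Δ_{p_c}, Δ̃_{p_c}`
(`LaceExpansionXSpacePsiBounds.lean`). Everything is PROVED, in `[0, ∞]`, with no hypothesis on `d`:

* weights and weighted lines: `wE b v = |v|^b`, `gE d b v = G^{(b)}(v) = |v|^b τ(v)`,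
  `gTildeE d c v = G̃^{(c)}(v) = |v|^c τ̃(v)`; `haraWBar`/`haraTBar` in this language, their symmetry
  in `(b,c)` (commutativity of the convolution), and the finiteness chain from Hara's hypotheses:
  `haraGBar_le_haraWBar` (`Ḡ^{(c)} ≤ W̄^{(c,0)}`), `haraWBar_le_haraTBar` (`W̄^{(c,0)} ≤ T̄^{(0,c)}`),
  `haraWBar_zero_left_le`, `haraWBar_zero_zero_le` (bubble `≤ W̄^{(b,0)} + 1`), `percTriBar_le`
  (`Δ_{p_c} ≤ T̄^{(0,c)} + W̄^{(0,0)}`), `percTriTildeBar_le` (`Δ̃_{p_c} ≤ 2d Δ_{p_c}`);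
* the pivotal line: `gTildeE_le` (`G̃^{(c)}(v) ≤ 2^c p_c Σ_i [G^{(c)}(v∓e_i) + τ(v∓e_i)]`, from
  `|v| ≤ |v - e| + 1`; Hara: "`2dp(D⋆G)(y-x)` … is almost the same as `G(y-x)`", "Some care is needed
  when `|y-x| = 1` can happen"), whence `wForm_gTildeE_le`, `tForm_gTildeE_le`;
* propagators `kProp f g` (`P_{f,g}((s,t),(u,v)) = f(u-s) g(v-t)`; `B₁ = P_{τ,τ̃}`), crossed
  propagators `kPropX` (the path lines of `B₂⁽¹⁾`), rungs `kRungR`, `kRungL`, the weighted kernels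
  `kB1w d b c = P_{G^{(b)},G̃^{(c)}}`, `kB2oneW = ρ P×_{G^{(b)},G^{(c)}} ρ'`, `kB2twoW` (weight on the path
  line of `B₂⁽²⁾`, weight `|0|^c` on its vanishing displacement), `kB2W`, the start/end kernels
  `kStartW`, `kEndW` (`A₃(0,u,w) = (P_{τ,τ}ρ)((0,0),(w,u))`, `A₃(z,t,x) = (ρP_{τ,τ})((z,t),(x,x))`), the
  point mass `vDelta` and the diagonal `eDiag`, and `tsum_mul_piNDiagramPc_succ_eq`: `Σ_x F(x)
  [diagram of Π^{(N+1)}](x)` is the chain `δ_{(0,0)} · A₃-start · B₁B₂⋯B₁ · A₃-end` against `δ_diag F`;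
* PIECE ESTIMATES: `pkNormMix_kProp_le`/`_kPropX_le` (mixed norm = `W`-form), `pkNormInf_kRungR_kProp_le`,
  `pkNormOne_kRungL_kProp_le` (a propagator closed by a rung = `T`-form: the open triangles of
  (7.5.13)), `pkNormInf_kProp_kB2twoW_le` / `pkNormOne_kB2twoW_kProp_le` (the computation (7.5.14),
  resp. its reverse, with general lines: `≤ |0|^c T̄^{(0,b)} ‖Pρ‖`), `pkNormInf_kProp_kB2_le`,
  `pkNormOne_kB2_kProp_le`, `pkNormInf_kProp_kB2W_le`, `pkNormOne_kB2W_kProp_le`; for the weighted `B₁`: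
  `pkNormMix_kB1w_le` (`≤ 2^c 2d (W̄^{(b,c)} + W̄^{(b,0)})`), `pkNormInf_kRungR_kB1w_le`,
  `pkNormOne_kRungL_kB1w_le`, `pkNormInf_kB1w_kB2_le`, `pkNormOne_kB2_kB1w_le`
  (`≤ 2Δ_{p_c} 2^c 2d (T̄^{(b,c)} + T̄^{(b,0)})`); the weighted `B₂⁽¹⁾` in the middle
  `pkNormMix_mid_kB2oneW_le` (`≤ ‖Xρ‖_{∞→∞} W̄^{(b,c)} ‖ρ'Y‖_{1→1}`); start/end:
  `pkNormMix_kStartW_le`, `pkNormMix_kEndW_le` (`≤ W̄^{(b,c)}`), `pkNormInf_kStartW_le`,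
  `pkNormOne_kEndW_le` (`≤ T̄^{(b,c)}`); unweighted checks `pkNormInf_kRungR_kB1_le`,
  `pkNormOne_kRungL_kB1_le` (`≤ Δ̃_{p_c}`), `pkNormInf_kB1_kB2_le'` (`≤ 2Δ_{p_c}Δ̃_{p_c}`, (7.5.12) again).

Not here (next layers): the `H^{(β)}`-piece `B₁ B̃₂⁽²⁾ B₁` (case (b-7)), the distribution of the
weight `|x|^{β+γ}` along the two paths (Step 1) and the assembly of Step 3.

## References

* T. Hara, Ann. Probab. 36 (2008) 530–593 (arXiv:math-ph/0504021): §1.1 (`G^{(α)}, W^{(β,γ)},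
  T^{(β,γ)}` and their suprema); §3.4 (the pivotal line `2dp(D⋆G)`; Step 1; Step 2 with cases (b-2),
  (b-3); Step 3).
* M. Heydenreich, R. van der Hofstad, *Progress in High-Dimensional Percolation and Random
  Graphs*, Springer 2017: (7.2.1)–(7.2.4), (7.4.2)–(7.4.4), (7.4.10), (7.5.5), (7.5.10),
  (7.5.12)–(7.5.14), (7.5.21)–(7.5.23), (7.5.29), Exercise 7.5, §7.5.2 (the vanishing displacement).
-/

noncomputable section

namespace Literature.Barriers.CriticalPhenomena

open _root_.MeasureTheory _root_.Filter Literature.Probability.LatticeModels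
  Literature.Probability.Percolation

open scoped ENNReal

section WeightedLinesPart

variable {d : ℕ}

/-! ### Weights and weighted lines in `[0, ∞]` -/

/-- The weight `|v|^b ∈ [0, ∞]` (`|·|` the Euclidean norm; `|0|^0 = 1`). [cite: Hara2008, §1.1 (G^{(α)})] -/
def wE (b : ℝ) (v : Site d) : ℝ≥0∞ := ENNReal.ofReal (euclidNorm v ^ b)

/-- The weighted line `G^{(b)}(v) = |v|^b τ_{p_c}(0, v) ∈ [0, ∞]`. [cite: Hara2008, §1.1 (G^{(α)})] -/
def gE (d : ℕ) (b : ℝ) (v : Site d) : ℝ≥0∞ := ENNReal.ofReal (haraG d b v)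

/-- `G^{(b)}(v) = |v|^b · τ(v)`. [folklore] -/
theorem gE_eq (b : ℝ) (v : Site d) : gE d b v = wE b v * tauPcE d v := by
  rw [gE, haraG, ENNReal.ofReal_mul (Real.rpow_nonneg (euclidNorm_nonneg v) b), wE, tauPcE]

/-- `|v|^0 = 1`. [folklore] -/
@[simp] theorem wE_zero_exp (v : Site d) : wE 0 v = 1 := by simp [wE]

/-- `|-v|^b = |v|^b`. [folklore] -/
theorem wE_neg (b : ℝ) (v : Site d) : wE b (-v) = wE b v := by rw [wE, wE, euclidNorm_neg]

/-- `|x - y|^b = |y - x|^b`. [folklore] -/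
theorem wE_sub_comm (b : ℝ) (x y : Site d) : wE b (x - y) = wE b (y - x) := by
  rw [← neg_sub, wE_neg]

/-- `G^{(0)} = τ`. [folklore] -/
@[simp] theorem gE_zero_exp (v : Site d) : gE d 0 v = tauPcE d v := by rw [gE_eq, wE_zero_exp, one_mul]

/-- `G^{(b)}(-v) = G^{(b)}(v)`. [folklore] -/
theorem gE_neg (b : ℝ) (v : Site d) : gE d b (-v) = gE d b v := by
  rw [gE_eq, gE_eq, wE_neg, tauPcE_neg]

/-- `G^{(b)}(x - y) = G^{(b)}(y - x)`. [folklore] -/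
theorem gE_sub_comm (b : ℝ) (x y : Site d) : gE d b (x - y) = gE d b (y - x) := by
  rw [← neg_sub, gE_neg]

/-- `|v|^b ≥ 1` for `v ≠ 0` and `b ≥ 0` (lattice points have norm at least one). [folklore] -/
theorem one_le_wE {b : ℝ} (hb : 0 ≤ b) {v : Site d} (hv : v ≠ 0) : 1 ≤ wE b v := by
  rw [wE, ← ENNReal.ofReal_one]
  exact ENNReal.ofReal_le_ofReal (Real.one_le_rpow
    ((one_le_norm_of_ne_zero hv).trans (norm_le_euclidNorm _)) hb)

/-- `|0|^b = 0` for `b > 0` (and `= 1` for `b = 0`): `|0|^b ≤ 1`. [folklore] -/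
theorem wE_zero_le_one (b : ℝ) : wE b (0 : Site d) ≤ 1 := by
  rw [wE, euclidNorm_zero', ← ENNReal.ofReal_one]
  refine ENNReal.ofReal_le_ofReal ?_
  rcases eq_or_ne b 0 with rfl | hb
  · simp
  · rw [Real.zero_rpow hb]; exact zero_le_one

/-- **Weight monotonicity**: `τ(v) ≤ G^{(b)}(v) + δ_{v,0}` for `b ≥ 0`. [folklore] -/
theorem tauPcE_le_gE_add_ite {b : ℝ} (hb : 0 ≤ b) (v : Site d) :
    tauPcE d v ≤ gE d b v + if v = 0 then 1 else 0 := by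
  by_cases hv : v = 0
  · rw [if_pos hv, hv, tauPcE_zero]
    exact le_add_self
  · rw [if_neg hv, add_zero, gE_eq]
    exact le_mul_of_one_le_left zero_le (one_le_wE hb hv)

/-- `G^{(b)}(v) ≤ Ḡ`-type pointwise bound: `G^{(b)}(v) ≤ |v|^b` (`τ ≤ 1`). [folklore] -/
theorem gE_le_wE (b : ℝ) (v : Site d) : gE d b v ≤ wE b v := by
  rw [gE_eq]
  exact mul_le_of_le_one_right zero_le (ENNReal.ofReal_le_one.2 (tau_le_one _ _ _))

/-! ### Hara's suprema in terms of the weighted lines -/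

/-- `Ḡ^{(b)} = sup_a G^{(b)}(a)`. [cite: Hara2008, §1.1] -/
theorem haraGBar_eq (b : ℝ) : haraGBar d b = ⨆ a : Site d, gE d b a := rfl

/-- `W̄^{(b,c)} = sup_a Σ_y G^{(b)}(y) G^{(c)}(a - y)`. [cite: Hara2008, §1.1] -/
theorem haraWBar_eq (b c : ℝ) :
    haraWBar d b c = ⨆ a : Site d, ∑' y : Site d, gE d b y * gE d c (a - y) := by
  unfold haraWBar
  refine iSup_congr fun a => tsum_congr fun y => ?_
  rw [ENNReal.ofReal_mul (haraG_nonneg _ _ _), gE, gE]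

/-- `T̄^{(b,c)} = sup_a Σ_{x,y} G^{(b)}(x) G^{(c)}(y - x) τ(a - y)`. [cite: Hara2008, §1.1] -/
theorem haraTBar_eq (b c : ℝ) :
    haraTBar d b c = ⨆ a : Site d, ∑' xy : Site d × Site d,
      gE d b xy.1 * gE d c (xy.2 - xy.1) * tauPcE d (a - xy.2) := by
  unfold haraTBar
  refine iSup_congr fun a => tsum_congr fun xy => ?_
  rw [ENNReal.ofReal_mul (mul_nonneg (haraG_nonneg _ _ _) (haraG_nonneg _ _ _)),
    ENNReal.ofReal_mul (haraG_nonneg _ _ _), gE, gE, tauPcE]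

/-- `Σ_y G^{(b)}(y) G^{(c)}(a - y) ≤ W̄^{(b,c)}`. [cite: Hara2008, §1.1] -/
theorem tsum_gE_mul_gE_le (b c : ℝ) (a : Site d) :
    ∑' y : Site d, gE d b y * gE d c (a - y) ≤ haraWBar d b c := by
  rw [haraWBar_eq]
  exact le_iSup (fun a : Site d => ∑' y : Site d, gE d b y * gE d c (a - y)) a

/-- `Σ_{x,y} G^{(b)}(x) G^{(c)}(y - x) τ(a - y) ≤ T̄^{(b,c)}`. [cite: Hara2008, §1.1] -/
theorem tsum_gE_gE_tau_le (b c : ℝ) (a : Site d) :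
    ∑' xy : Site d × Site d, gE d b xy.1 * gE d c (xy.2 - xy.1) * tauPcE d (a - xy.2) ≤ haraTBar d b c := by
  rw [haraTBar_eq]
  exact le_iSup (fun a : Site d => ∑' xy : Site d × Site d,
    gE d b xy.1 * gE d c (xy.2 - xy.1) * tauPcE d (a - xy.2)) a

/-- **`W̄^{(b,c)} = W̄^{(c,b)}`** (commutativity of the convolution). [folklore] -/
theorem haraWBar_comm (b c : ℝ) : haraWBar d b c = haraWBar d c b := by
  rw [haraWBar_eq, haraWBar_eq]
  refine iSup_congr fun a => ?_
  rw [tsum_reflect_shift _ a]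
  refine tsum_congr fun y => ?_
  rw [sub_sub_cancel, mul_comm]

/-- **`T̄^{(b,c)} = T̄^{(c,b)}`** (commutativity of the convolution `G^{(b)} ⋆ G^{(c)}`). [folklore] -/
theorem haraTBar_comm (b c : ℝ) : haraTBar d b c = haraTBar d c b := by
  rw [haraTBar_eq, haraTBar_eq]
  refine iSup_congr fun a => ?_
  rw [ENNReal.tsum_prod', ENNReal.tsum_prod', ENNReal.tsum_comm]
  conv_rhs => rw [ENNReal.tsum_comm]
  refine tsum_congr fun y => ?_
  rw [tsum_reflect_shift _ y]
  refine tsum_congr fun x => ?_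
  rw [sub_sub_cancel, mul_comm (gE d b (y - x))]

/-! ### Finiteness of the auxiliary suprema from Hara's hypotheses -/

/-- `Ḡ^{(c)} ≤ W̄^{(c,0)}` (the term `y = a`: `G^{(c)}(a) τ(0)`). [folklore] -/
theorem haraGBar_le_haraWBar (c : ℝ) : haraGBar d c ≤ haraWBar d c 0 := by
  rw [haraGBar_eq]
  refine iSup_le fun a => le_trans ?_ (tsum_gE_mul_gE_le c 0 a)
  calc gE d c a = gE d c a * gE d 0 (a - a) := by rw [sub_self, gE_zero_exp, tauPcE_zero, mul_one]
    _ ≤ ∑' y : Site d, gE d c y * gE d 0 (a - y) :=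
        ENNReal.le_tsum (f := fun y => gE d c y * gE d 0 (a - y)) a

/-- **`W̄^{(c,0)} ≤ T̄^{(0,c)}`** (the terms `x = 0` of `T^{(0,c)}(a)`; used by Hara for the
`γ`-weighted bubble). [folklore] -/
theorem haraWBar_le_haraTBar (c : ℝ) : haraWBar d c 0 ≤ haraTBar d 0 c := by
  rw [haraWBar_eq]
  refine iSup_le fun a => le_trans ?_ (tsum_gE_gE_tau_le 0 c a)
  calc ∑' y : Site d, gE d c y * gE d 0 (a - y)
      = ∑' y : Site d, gE d 0 0 * gE d c ((0, y).2 - (0, y).1) * tauPcE d (a - (0, y).2) := by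
        refine tsum_congr fun y => ?_
        simp only [gE_zero_exp, tauPcE_zero, one_mul, sub_zero]
    _ ≤ ∑' xy : Site d × Site d, gE d 0 xy.1 * gE d c (xy.2 - xy.1) * tauPcE d (a - xy.2) :=
        ENNReal.tsum_comp_le_tsum_of_injective (f := fun y : Site d => ((0 : Site d), y))
          (fun y y' h => congrArg Prod.snd h) _

/-- **`W̄^{(0,c)} ≤ W̄^{(b,c)} + Ḡ^{(c)}`** for `b ≥ 0` (weight monotonicity `τ ≤ G^{(b)} + δ₀`). [folklore] -/
theorem haraWBar_zero_left_le {b : ℝ} (hb : 0 ≤ b) (c : ℝ) :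
    haraWBar d 0 c ≤ haraWBar d b c + haraGBar d c := by
  rw [haraWBar_eq]
  refine iSup_le fun a => ?_
  calc ∑' y : Site d, gE d 0 y * gE d c (a - y)
      ≤ ∑' y : Site d, (gE d b y * gE d c (a - y) + (if y = 0 then 1 else 0) * gE d c (a - y)) := by
        refine ENNReal.tsum_le_tsum fun y => ?_
        rw [gE_zero_exp, ← add_mul]
        exact mul_le_mul' (tauPcE_le_gE_add_ite hb y) le_rfl
    _ = (∑' y : Site d, gE d b y * gE d c (a - y)) + gE d c a := by
        rw [ENNReal.tsum_add]
        congr 1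
        rw [tsum_eq_single (0 : Site d)]
        · simp
        · intro y hy; simp [hy]
    _ ≤ haraWBar d b c + haraGBar d c :=
        add_le_add (tsum_gE_mul_gE_le b c a) (le_iSup (fun a => gE d c a) a)

/-- The **bubble** `sup_a Σ_y τ(y) τ(a - y) = W̄^{(0,0)} ≤ W̄^{(b,0)} + 1` (`b ≥ 0`). [folklore] -/
theorem haraWBar_zero_zero_le {b : ℝ} (hb : 0 ≤ b) : haraWBar d 0 0 ≤ haraWBar d b 0 + 1 := by
  refine (haraWBar_zero_left_le hb 0).trans (add_le_add le_rfl ?_)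
  rw [haraGBar_eq]
  exact iSup_le fun a => by rw [gE_zero_exp]; exact ENNReal.ofReal_le_one.2 (tau_le_one _ _ _)

/-- `Σ_y τ(y) τ(a - y) ≤ W̄^{(0,0)}` (the open bubble). [folklore] -/
theorem percBubble_le (a : Site d) : percBubble d a ≤ haraWBar d 0 0 := by
  refine le_trans (le_of_eq ?_) (tsum_gE_mul_gE_le 0 0 a)
  exact tsum_congr fun y => by rw [gE_zero_exp, gE_zero_exp]

/-- **`Δ_{p_c} ≤ T̄^{(0,c)} + W̄^{(0,0)}`** for `c ≥ 0` (weight monotonicity on the middle line; the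
terms `y = x` are the bubble). [folklore] -/
theorem percTriBar_le {c : ℝ} (hc : 0 ≤ c) : percTriBar d ≤ haraTBar d 0 c + haraWBar d 0 0 := by
  refine iSup_le fun a => ?_
  calc percTri d a
      ≤ ∑' xy : Site d × Site d, (gE d 0 xy.1 * gE d c (xy.2 - xy.1) * tauPcE d (a - xy.2) +
          gE d 0 xy.1 * (if xy.2 - xy.1 = 0 then 1 else 0) * tauPcE d (a - xy.2)) := by
        refine ENNReal.tsum_le_tsum fun xy => ?_
        rw [gE_zero_exp, ← add_mul, ← mul_add]
        exact mul_le_mul' (mul_le_mul' le_rfl (tauPcE_le_gE_add_ite hc _)) le_rfl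
    _ = (∑' xy : Site d × Site d, gE d 0 xy.1 * gE d c (xy.2 - xy.1) * tauPcE d (a - xy.2)) +
          ∑' xy : Site d × Site d, gE d 0 xy.1 * (if xy.2 - xy.1 = 0 then 1 else 0) * tauPcE d (a - xy.2) :=
        ENNReal.tsum_add
    _ ≤ haraTBar d 0 c + haraWBar d 0 0 := add_le_add (tsum_gE_gE_tau_le 0 c a) ?_
  -- the diagonal terms are the bubble
  calc ∑' xy : Site d × Site d, gE d 0 xy.1 * (if xy.2 - xy.1 = 0 then 1 else 0) * tauPcE d (a - xy.2)
      = ∑' x : Site d, ∑' y : Site d, gE d 0 x * (if y - x = 0 then 1 else 0) * tauPcE d (a - y) := by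
        rw [ENNReal.tsum_prod']
    _ = ∑' x : Site d, gE d 0 x * tauPcE d (a - x) := by
        refine tsum_congr fun x => ?_
        rw [tsum_eq_single x]
        · simp
        · intro y hy; simp [sub_ne_zero.2 hy]
    _ ≤ haraWBar d 0 0 := by
        refine le_trans (le_of_eq (tsum_congr fun x => ?_)) (tsum_gE_mul_gE_le 0 0 a)
        rw [gE_zero_exp, gE_zero_exp]

/-- `τ̃(v) = p_c Σ_i [τ(v - e_i) + τ(v + e_i)]` in `[0, ∞]`. [cite: HeydenreichVanDerHofstad2017, (7.2.3)] -/
theorem tauTildePcE_eq (v : Site d) : tauTildePcE d v = ENNReal.ofReal (criticalProbI d) *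
    ∑ i : Fin d, (tauPcE d (v - Pi.single i 1) + tauPcE d (v + Pi.single i 1)) := by
  rw [tauTildePcE, tauTildePc, ENNReal.ofReal_mul (criticalProbI d).2.1,
    ENNReal.ofReal_sum_of_nonneg (fun i _ => add_nonneg (tau_nonneg _ _ _) (tau_nonneg _ _ _))]
  congr 1
  refine Finset.sum_congr rfl fun i _ => ?_
  rw [ENNReal.ofReal_add (tau_nonneg _ _ _) (tau_nonneg _ _ _), ofReal_tau_eq, ofReal_tau_eq,
    zero_add, zero_sub, show v - -Pi.single i (1 : ℤ) = v + Pi.single i 1 by abel]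

/-- `p_c ≤ 1` in `[0, ∞]`. [folklore] -/
theorem ofReal_criticalProbI_le_one : ENNReal.ofReal (criticalProbI d : ℝ) ≤ 1 :=
  ENNReal.ofReal_le_one.2 (criticalProbI d).2.2

/-- **`Δ̃_{p_c}(x) = p_c Σ_i [Δ_{p_c}(x - e_i) + Δ_{p_c}(x + e_i)] ≤ 2d Δ_{p_c}`**. [folklore] -/
theorem percTriTilde_le (x : Site d) : percTriTilde d x ≤ 2 * d * percTriBar d := by
  calc percTriTilde d x
      = ∑' yz : Site d × Site d, ENNReal.ofReal (criticalProbI d) * ∑ i : Fin d,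
          (tauPcE d yz.1 * tauPcE d (yz.2 - yz.1) * tauPcE d (x - Pi.single i 1 - yz.2) +
            tauPcE d yz.1 * tauPcE d (yz.2 - yz.1) * tauPcE d (x + Pi.single i 1 - yz.2)) := by
        refine tsum_congr fun yz => ?_
        rw [tauTildePcE_eq, ← mul_assoc, mul_comm _ (ENNReal.ofReal _), mul_assoc, Finset.mul_sum]
        congr 1
        refine Finset.sum_congr rfl fun i _ => ?_
        rw [mul_add, show x - yz.2 - Pi.single i 1 = x - Pi.single i 1 - yz.2 by abel,
          show x - yz.2 + Pi.single i 1 = x + Pi.single i 1 - yz.2 by abel]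
    _ = ENNReal.ofReal (criticalProbI d) * ∑ i : Fin d,
          (percTri d (x - Pi.single i 1) + percTri d (x + Pi.single i 1)) := by
        rw [ENNReal.tsum_mul_left]
        congr 1
        rw [Summable.tsum_finsetSum (fun i _ => ENNReal.summable)]
        refine Finset.sum_congr rfl fun i _ => ?_
        rw [ENNReal.tsum_add]
        rfl
    _ ≤ 1 * ∑ _i : Fin d, (percTriBar d + percTriBar d) := by
        refine mul_le_mul' ofReal_criticalProbI_le_one (Finset.sum_le_sum fun i _ => ?_)
        exact add_le_add (le_iSup (percTri d) _) (le_iSup (percTri d) _)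
    _ = 2 * d * percTriBar d := by
        rw [one_mul, Finset.sum_const, Finset.card_univ, Fintype.card_fin, nsmul_eq_mul]
        ring

/-- **`Δ̃_{p_c} ≤ 2d Δ_{p_c}`**. [folklore] -/
theorem percTriTildeBar_le : percTriTildeBar d ≤ 2 * d * percTriBar d :=
  iSup_le fun x => percTriTilde_le x

/-! ### The weighted pivotal line -/

/-- The weighted pivotal line `G̃^{(c)}(v) := |v|^c τ̃(v) ∈ [0, ∞]`.
[cite: Hara2008, §3.4 (the line 2dp(D⋆G) and its weighted version)] -/
def gTildeE (d : ℕ) (c : ℝ) (v : Site d) : ℝ≥0∞ := wE c v * tauTildePcE d v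

/-- `(a + 1)^c ≤ 2^c (a^c + 1)` for `a, c ≥ 0`. [folklore] -/
theorem add_one_rpow_le {a c : ℝ} (ha : 0 ≤ a) (hc : 0 ≤ c) : (a + 1) ^ c ≤ 2 ^ c * (a ^ c + 1) := by
  rcases le_total a 1 with h | h
  · calc (a + 1) ^ c ≤ (2 : ℝ) ^ c := Real.rpow_le_rpow (by linarith) (by linarith) hc
      _ ≤ 2 ^ c * (a ^ c + 1) := le_mul_of_one_le_right (by positivity)
          (le_add_of_nonneg_left (Real.rpow_nonneg ha c))
  · calc (a + 1) ^ c ≤ (2 * a) ^ c := Real.rpow_le_rpow (by linarith) (by linarith) hc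
      _ = 2 ^ c * a ^ c := Real.mul_rpow (by norm_num) ha
      _ ≤ 2 ^ c * (a ^ c + 1) := mul_le_mul_of_nonneg_left (le_add_of_nonneg_right zero_le_one)
          (by positivity)

/-- `|v|^c ≤ 2^c (|v - e|^c + 1)` for a unit vector `e` and `c ≥ 0` (`|v| ≤ |v - e| + 1`). [folklore] -/
theorem wE_le_of_unit {c : ℝ} (hc : 0 ≤ c) (v e : Site d) (he : euclidNorm e = 1) :
    wE c v ≤ ENNReal.ofReal (2 ^ c) * (wE c (v - e) + 1) := by
  have h1 : euclidNorm v ≤ euclidNorm (v - e) + 1 := by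
    have := euclidNorm_add_le (v - e) e
    rwa [sub_add_cancel, he] at this
  calc wE c v ≤ ENNReal.ofReal ((euclidNorm (v - e) + 1) ^ c) :=
        ENNReal.ofReal_le_ofReal (Real.rpow_le_rpow (euclidNorm_nonneg v) h1 hc)
    _ ≤ ENNReal.ofReal (2 ^ c * (euclidNorm (v - e) ^ c + 1)) :=
        ENNReal.ofReal_le_ofReal (add_one_rpow_le (euclidNorm_nonneg _) hc)
    _ = ENNReal.ofReal (2 ^ c) * (wE c (v - e) + 1) := by
        rw [ENNReal.ofReal_mul (by positivity),
          ENNReal.ofReal_add (Real.rpow_nonneg (euclidNorm_nonneg _) c) zero_le_one,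
          ENNReal.ofReal_one, wE]

/-- **The weighted pivotal line is dominated by shifted weighted and unweighted lines**:
`G̃^{(c)}(v) ≤ 2^c p_c Σ_i [G^{(c)}(v - e_i) + τ(v - e_i) + G^{(c)}(v + e_i) + τ(v + e_i)]` (`c ≥ 0`;
Hara: `2dp(D⋆G)(y-x)` "is almost the same as `G(y-x)` for large `|y-x|`").
[cite: Hara2008, §3.4 (the pivotal line 2dp(D⋆G), "Some care is needed when |y-x| = 1 can happen")] -/
theorem gTildeE_le {c : ℝ} (hc : 0 ≤ c) (v : Site d) :
    gTildeE d c v ≤ ENNReal.ofReal (2 ^ c) * ENNReal.ofReal (criticalProbI d) * ∑ i : Fin d,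
      (gE d c (v - Pi.single i 1) + tauPcE d (v - Pi.single i 1) +
        (gE d c (v + Pi.single i 1) + tauPcE d (v + Pi.single i 1))) := by
  have key : ∀ e : Site d, euclidNorm e = 1 →
      wE c v * tauPcE d (v - e) ≤ ENNReal.ofReal (2 ^ c) * (gE d c (v - e) + tauPcE d (v - e)) := by
    intro e he
    calc wE c v * tauPcE d (v - e) ≤ ENNReal.ofReal (2 ^ c) * (wE c (v - e) + 1) * tauPcE d (v - e) :=
          mul_le_mul' (wE_le_of_unit hc v e he) le_rfl
      _ = ENNReal.ofReal (2 ^ c) * (gE d c (v - e) + tauPcE d (v - e)) := by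
          rw [mul_assoc, add_mul, one_mul, gE_eq]
  have hunit : ∀ i : Fin d, euclidNorm (Pi.single i (1 : ℤ) : Site d) = 1 := fun i => by
    rw [euclidNorm_single]; simp
  have hunit' : ∀ i : Fin d, euclidNorm (-(Pi.single i (1 : ℤ) : Site d)) = 1 := fun i => by
    rw [euclidNorm_neg]; exact hunit i
  calc gTildeE d c v
      = ENNReal.ofReal (criticalProbI d) * ∑ i : Fin d,
          (wE c v * tauPcE d (v - Pi.single i 1) + wE c v * tauPcE d (v + Pi.single i 1)) := by
        rw [gTildeE, tauTildePcE_eq, ← mul_assoc, mul_comm (wE c v), mul_assoc, Finset.mul_sum]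
        congr 1
        exact Finset.sum_congr rfl fun i _ => mul_add _ _ _
    _ ≤ ENNReal.ofReal (criticalProbI d) * ∑ i : Fin d, ENNReal.ofReal (2 ^ c) *
          (gE d c (v - Pi.single i 1) + tauPcE d (v - Pi.single i 1) +
            (gE d c (v + Pi.single i 1) + tauPcE d (v + Pi.single i 1))) := by
        refine mul_le_mul' le_rfl (Finset.sum_le_sum fun i _ => ?_)
        rw [mul_add (ENNReal.ofReal (2 ^ c))]
        refine add_le_add (key _ (hunit i)) ?_
        have := key (-(Pi.single i 1)) (hunit' i)
        rwa [sub_neg_eq_add] at this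
    _ = ENNReal.ofReal (2 ^ c) * ENNReal.ofReal (criticalProbI d) * ∑ i : Fin d,
          (gE d c (v - Pi.single i 1) + tauPcE d (v - Pi.single i 1) +
            (gE d c (v + Pi.single i 1) + tauPcE d (v + Pi.single i 1))) := by
        rw [← Finset.mul_sum, ← mul_assoc, mul_comm (ENNReal.ofReal (criticalProbI d : ℝ))]


end WeightedLinesPart

/-! ### Two-line propagators and their norms -/

section Propagators

variable {d : ℕ}

/-- The **free two-line propagator** with lines `f` (first coordinates) and `g` (second
coordinates): `P_{f,g}((s,t),(u,v)) = f(u - s) g(v - t)` (e.g. `B₁ = P_{τ,τ̃}`, its weighted versions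
`P_{G^{(b)},G̃^{(c)}}`, the two lines out of `0` and into `x`). [cite: HeydenreichVanDerHofstad2017, (7.4.3)] -/
def kProp (f g : Site d → ℝ≥0∞) (p q : Site d × Site d) : ℝ≥0∞ := f (q.1 - p.1) * g (q.2 - p.2)

/-- The **crossed propagator** `P×_{f,g}((z,t),(w',u')) = f(u' - z) g(w' - t)` (the two path lines
`τ(u'-z)`, `τ(w'-t)` of `B₂⁽¹⁾(z,t,w',u')`, which interchange the coordinates).
[cite: HeydenreichVanDerHofstad2017, (7.4.4)] -/
def kPropX (f g : Site d → ℝ≥0∞) (p q : Site d × Site d) : ℝ≥0∞ := f (q.2 - p.1) * g (q.1 - p.2)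

/-- The **`W`-form** `sup_a Σ_y f(y) g(a - y)` of two lines (`= W̄^{(b,c)}` for `f = G^{(b)}`,
`g = G^{(c)}`). [cite: Hara2008, §1.1 (W^{(β,γ)})] -/
def wForm (f g : Site d → ℝ≥0∞) : ℝ≥0∞ := ⨆ a : Site d, ∑' y : Site d, f y * g (a - y)

/-- The **`T`-form** `sup_a Σ_{x,y} f(x) g(y - x) τ(a - y)` of two lines closed by a `τ`-line
(`= T̄^{(b,c)}` for `f = G^{(b)}`, `g = G^{(c)}`). [cite: Hara2008, §1.1 (T^{(β,γ)})] -/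
def tForm (d : ℕ) (f g : Site d → ℝ≥0∞) : ℝ≥0∞ :=
  ⨆ a : Site d, ∑' xy : Site d × Site d, f xy.1 * g (xy.2 - xy.1) * tauPcE d (a - xy.2)

/-- `W̄^{(b,c)}` is the `W`-form of `G^{(b)}, G^{(c)}`. [cite: Hara2008, §1.1] -/
theorem haraWBar_eq_wForm (b c : ℝ) : haraWBar d b c = wForm (gE d b) (gE d c) := haraWBar_eq b c

/-- `T̄^{(b,c)}` is the `T`-form of `G^{(b)}, G^{(c)}`. [cite: Hara2008, §1.1] -/
theorem haraTBar_eq_tForm (b c : ℝ) : haraTBar d b c = tForm d (gE d b) (gE d c) := haraTBar_eq b c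

/-- A term of the `W`-form is at most the form. [folklore] -/
theorem tsum_le_wForm (f g : Site d → ℝ≥0∞) (a : Site d) : ∑' y, f y * g (a - y) ≤ wForm f g :=
  le_iSup (fun a : Site d => ∑' y : Site d, f y * g (a - y)) a

/-- A term of the `T`-form is at most the form. [folklore] -/
theorem tsum_le_tForm (f g : Site d → ℝ≥0∞) (a : Site d) :
    ∑' xy : Site d × Site d, f xy.1 * g (xy.2 - xy.1) * tauPcE d (a - xy.2) ≤ tForm d f g :=
  le_iSup (fun a : Site d => ∑' xy : Site d × Site d, f xy.1 * g (xy.2 - xy.1) * tauPcE d (a - xy.2)) a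

/-- **The mixed norm of a propagator is a `W`-form**: `‖P_{f,g}‖_mix ≤ sup_a Σ_y f(y) g(a - y)`
for even `g`. [cite: HeydenreichVanDerHofstad2017, (7.5.21)–(7.5.23)] -/
theorem pkNormMix_kProp_le (f g : Site d → ℝ≥0∞) (hg : ∀ v, g (-v) = g v) :
    pkNormMix (kProp f g) ≤ wForm f g := by
  refine iSup_le fun q => ?_
  obtain ⟨s, a₁, a₂⟩ := q
  dsimp only
  calc ∑' u : Site d, kProp f g (s, s + a₁) (u, u + a₂)
      = ∑' u : Site d, f (u - s) * g ((s + a₁ - a₂) - u) := by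
        refine tsum_congr fun u => ?_
        rw [kProp, show u + a₂ - (s + a₁) = -((s + a₁ - a₂) - u) by abel, hg]
    _ = ∑' u : Site d, f u * g ((s + a₁ - a₂ - s) - u) := tsum_series2 f g s (s + a₁ - a₂)
    _ ≤ wForm f g := tsum_le_wForm f g _

/-- **The mixed norm of a crossed propagator is a `W`-form**: `‖P×_{f,g}‖_mix ≤ sup_a Σ_y f(y) g(a-y)`
for even `g`. [cite: HeydenreichVanDerHofstad2017, (7.5.29)] -/
theorem pkNormMix_kPropX_le (f g : Site d → ℝ≥0∞) (hg : ∀ v, g (-v) = g v) :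
    pkNormMix (kPropX f g) ≤ wForm f g := by
  refine iSup_le fun q => ?_
  obtain ⟨s, a₁, a₂⟩ := q
  dsimp only
  calc ∑' u : Site d, kPropX f g (s, s + a₁) (u, u + a₂)
      = ∑' u : Site d, f (u - (s - a₂)) * g ((s + a₁) - u) := by
        refine tsum_congr fun u => ?_
        rw [kPropX, show u + a₂ - s = u - (s - a₂) by abel, show u - (s + a₁) = -((s + a₁) - u) by abel, hg]
    _ = ∑' u : Site d, f u * g ((s + a₁ - (s - a₂)) - u) := tsum_series2 f g (s - a₂) (s + a₁)
    _ ≤ wForm f g := tsum_le_wForm f g _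

/-- **`ℓ^∞ → ℓ^∞` norm of a propagator closed by a rung on the right is a `T`-form**:
`sup_{(s,t)} Σ_{(u,v)} f(u-s) g(v-t) τ(v-u) ≤ sup_a Σ_{x,y} f(x) g(y-x)… ` — precisely
`≤ tForm f g` for even `g` (the open triangle `Δ̃_p(u-w)` of (7.5.13) for `f = τ`, `g = τ̃`).
[cite: HeydenreichVanDerHofstad2017, (7.5.13)] -/
theorem pkNormInf_kProp_rung_le (f g : Site d → ℝ≥0∞) (hg : ∀ v, g (-v) = g v) :
    pkNormInf (fun p q => kProp f g p q * tauPcE d (q.2 - q.1)) ≤ tForm d f g := by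
  refine iSup_le fun p => ?_
  calc ∑' q : Site d × Site d, kProp f g p q * tauPcE d (q.2 - q.1)
      = ∑' q : Site d × Site d, f (q.1 - p.1) * tauPcE d (q.2 - q.1) * g (p.2 - q.2) := by
        refine tsum_congr fun q => ?_
        rw [kProp, show q.2 - p.2 = -(p.2 - q.2) by abel, hg]
        ring
    _ = ∑' q : Site d × Site d, f q.1 * tauPcE d (q.2 - q.1) * g (p.2 - p.1 - q.2) :=
        tsum_series3 f (tauPcE d) g p.1 p.2
    _ = ∑' q : Site d × Site d, f q.1 * g (q.2 - q.1) * tauPcE d (p.2 - p.1 - q.2) := by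
        rw [ENNReal.tsum_prod', ENNReal.tsum_prod']
        refine tsum_congr fun x => ?_
        rw [tsum_reflect_shift _ (p.2 - p.1 + x)]
        refine tsum_congr fun y => ?_
        rw [show p.2 - p.1 + x - y - x = -(y - (p.2 - p.1)) by abel, tauPcE_neg,
          show p.2 - p.1 - (p.2 - p.1 + x - y) = y - x by abel,
          show p.2 - p.1 - y = -(y - (p.2 - p.1)) by abel, tauPcE_neg]
        ring
    _ ≤ tForm d f g := tsum_le_tForm f g _

/-- **`ℓ¹ → ℓ¹` norm of a propagator closed by a rung on the left is a `T`-form**: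
`sup_{(u,v)} Σ_{(s,t)} τ(t-s) f(u-s) g(v-t) ≤ tForm f g` for even `f`.
[cite: HeydenreichVanDerHofstad2017, Exercise 7.5] -/
theorem pkNormOne_rung_kProp_le (f g : Site d → ℝ≥0∞) (hf : ∀ v, f (-v) = f v) :
    pkNormOne (fun p q => tauPcE d (p.2 - p.1) * kProp f g p q) ≤ tForm d f g := by
  refine iSup_le fun q => ?_
  -- reduce to the previous computation by the reflection `(s,t) ↦ (q - (s,t))`-type symmetry:
  -- Σ_{s,t} τ(t-s) f(u-s) g(v-t): substitute s' = u - s... we do it directly with `tsum_series3`.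
  calc ∑' p : Site d × Site d, tauPcE d (p.2 - p.1) * kProp f g p q
      = ∑' p : Site d × Site d, f (p.1 - q.1) * tauPcE d (p.2 - p.1) * g (q.2 - p.2) := by
        refine tsum_congr fun p => ?_
        rw [kProp, show q.1 - p.1 = -(p.1 - q.1) by abel, hf]
        ring
    _ = ∑' p : Site d × Site d, f p.1 * tauPcE d (p.2 - p.1) * g (q.2 - q.1 - p.2) :=
        tsum_series3 f (tauPcE d) g q.1 q.2
    _ = ∑' p : Site d × Site d, f p.1 * g (p.2 - p.1) * tauPcE d (q.2 - q.1 - p.2) := by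
        rw [ENNReal.tsum_prod', ENNReal.tsum_prod']
        refine tsum_congr fun x => ?_
        rw [tsum_reflect_shift _ (q.2 - q.1 + x)]
        refine tsum_congr fun y => ?_
        rw [show q.2 - q.1 + x - y - x = -(y - (q.2 - q.1)) by abel, tauPcE_neg,
          show q.2 - q.1 - (q.2 - q.1 + x - y) = y - x by abel,
          show q.2 - q.1 - y = -(y - (q.2 - q.1)) by abel, tauPcE_neg]
        ring
    _ ≤ tForm d f g := tsum_le_tForm f g _

/-- `B₁ = P_{τ, τ̃}`. [cite: HeydenreichVanDerHofstad2017, (7.4.3)] -/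
theorem kB1_eq_kProp : kB1 d = kProp (tauPcE d) (tauTildePcE d) := by
  funext p q
  rw [kB1, percB1_eq, kProp, mul_comm]

/-- **The weighted `B₁`**: `B̃₁^{(b,c)} := P_{G^{(b)}, G̃^{(c)}}`, weight `|·|^b` on the `τ`-line and
`|·|^c` on the pivotal line (`b = c = 0` is `B₁` itself). [cite: Hara2008, §3.4 (Step 1)] -/
def kB1w (d : ℕ) (b c : ℝ) : Site d × Site d → Site d × Site d → ℝ≥0∞ := kProp (gE d b) (gTildeE d c)

/-- `B̃₁^{(0,0)} = B₁`. [folklore] -/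
theorem kB1w_zero_zero : kB1w d 0 0 = kB1 d := by
  rw [kB1w, kB1_eq_kProp]
  congr 1
  · funext v; exact gE_zero_exp v
  · funext v; rw [gTildeE, wE_zero_exp, one_mul]

end Propagators

/-! ### Rungs, the two terms of `B₂` as kernels, and the algebra of the forms -/

section Rungs

variable {d : ℕ}

/-- A kernel followed by the rung `τ(v - u)` at its right pair. [cite: HeydenreichVanDerHofstad2017, (7.4.4)] -/
def kRungR (X : Site d × Site d → Site d × Site d → ℝ≥0∞) (p q : Site d × Site d) : ℝ≥0∞ :=
  X p q * tauPcE d (q.2 - q.1)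

/-- A kernel preceded by the rung `τ(t - s)` at its left pair. [cite: HeydenreichVanDerHofstad2017, (7.4.4)] -/
def kRungL (Y : Site d × Site d → Site d × Site d → ℝ≥0∞) (q r : Site d × Site d) : ℝ≥0∞ :=
  tauPcE d (q.2 - q.1) * Y q r

/-- A rung between two kernels may be attached to either. [folklore] -/
theorem pkMul_kRungR (X Y : Site d × Site d → Site d × Site d → ℝ≥0∞) :
    pkMul (kRungR X) Y = pkMul X (kRungL Y) := by
  funext p r
  exact tsum_congr fun q => mul_assoc _ _ _

/-- A left rung passes through a product. [folklore] -/
theorem kRungL_pkMul (X Y : Site d × Site d → Site d × Site d → ℝ≥0∞) :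
    kRungL (pkMul X Y) = pkMul (kRungL X) Y := by
  funext q r
  simp only [kRungL, pkMul, ← ENNReal.tsum_mul_left, mul_assoc]

/-- Right rungs preserve translation invariance. [folklore] -/
theorem pkTI_kRungR {X : Site d × Site d → Site d × Site d → ℝ≥0∞} (hX : PkTI X) : PkTI (kRungR X) := by
  intro c p q
  simp only [kRungR, hX c p q, add_sub_add_right_eq_sub]

/-- Left rungs preserve translation invariance. [folklore] -/
theorem pkTI_kRungL {Y : Site d × Site d → Site d × Site d → ℝ≥0∞} (hY : PkTI Y) : PkTI (kRungL Y) := by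
  intro c p q
  simp only [kRungL, hY c p q, add_sub_add_right_eq_sub]

/-- Propagators are translation invariant. [folklore] -/
theorem pkTI_kProp (f g : Site d → ℝ≥0∞) : PkTI (kProp f g) := by
  intro c p q
  simp only [kProp, add_sub_add_right_eq_sub]

/-- Crossed propagators are translation invariant. [folklore] -/
theorem pkTI_kPropX (f g : Site d → ℝ≥0∞) : PkTI (kPropX f g) := by
  intro c p q
  simp only [kPropX, add_sub_add_right_eq_sub]

/-- `B₂⁽¹⁾` as a kernel on pairs. [cite: HeydenreichVanDerHofstad2017, (7.4.4)] -/
def kB2one (d : ℕ) (p q : Site d × Site d) : ℝ≥0∞ := percB2one d p.1 p.2 q.1 q.2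

/-- `B₂⁽²⁾` as a kernel on pairs. [cite: HeydenreichVanDerHofstad2017, (7.4.4)] -/
def kB2two (d : ℕ) (p q : Site d × Site d) : ℝ≥0∞ := percB2two d p.1 p.2 q.1 q.2

/-- `B₂ = B₂⁽¹⁾ + B₂⁽²⁾` as kernels. [cite: HeydenreichVanDerHofstad2017, (7.4.4)] -/
theorem kB2_eq_add : kB2 d = fun p q => kB2one d p q + kB2two d p q := by
  funext p q
  exact percB2_eq _ _ _ _

/-- **`B₂⁽¹⁾ = ρ P×_{τ,τ} ρ'`**: a rung, the crossed propagator, a rung. [cite: HeydenreichVanDerHofstad2017, (7.4.4)] -/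
theorem kB2one_eq : kB2one d = kRungL (kRungR (kPropX (tauPcE d) (tauPcE d))) := by
  funext p q
  simp only [kB2one, percB2one, kRungL, kRungR, kPropX]
  ring

/-- Products distribute over sums of kernels (right factor). [folklore] -/
theorem pkMul_add_right (X Y Z : Site d × Site d → Site d × Site d → ℝ≥0∞) :
    pkMul X (fun p q => Y p q + Z p q) = fun p q => pkMul X Y p q + pkMul X Z p q := by
  funext p q
  simp only [pkMul, mul_add, ENNReal.tsum_add]

/-- Products distribute over sums of kernels (left factor). [folklore] -/
theorem pkMul_add_left (X Y Z : Site d × Site d → Site d × Site d → ℝ≥0∞) :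
    pkMul (fun p q => X p q + Y p q) Z = fun p q => pkMul X Z p q + pkMul Y Z p q := by
  funext p q
  simp only [pkMul, add_mul, ENNReal.tsum_add]

/-- `‖X + Y‖_{∞→∞} ≤ ‖X‖_{∞→∞} + ‖Y‖_{∞→∞}`. [folklore] -/
theorem pkNormInf_add_le (X Y : Site d × Site d → Site d × Site d → ℝ≥0∞) :
    pkNormInf (fun p q => X p q + Y p q) ≤ pkNormInf X + pkNormInf Y := by
  refine iSup_le fun p => ?_
  rw [ENNReal.tsum_add]
  exact add_le_add (tsum_le_pkNormInf X p) (tsum_le_pkNormInf Y p)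

/-- `‖X + Y‖_{1→1} ≤ ‖X‖_{1→1} + ‖Y‖_{1→1}`. [folklore] -/
theorem pkNormOne_add_le (X Y : Site d × Site d → Site d × Site d → ℝ≥0∞) :
    pkNormOne (fun p q => X p q + Y p q) ≤ pkNormOne X + pkNormOne Y := by
  refine iSup_le fun q => ?_
  rw [ENNReal.tsum_add]
  exact add_le_add (tsum_le_pkNormOne X q) (tsum_le_pkNormOne Y q)

/-- `Δ_{p_c}` is the `T`-form of `τ, τ`. [cite: HeydenreichVanDerHofstad2017, (7.2.1)] -/
theorem tForm_tau_tau : tForm d (tauPcE d) (tauPcE d) = percTriBar d := rfl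

/-- The `T`-form with the closing line and the second line interchanged:
`Σ_{x,y} f(x) h(y - x) g(a - y) = Σ_{x,y} f(x) g(y - x) h(a - y)` (commutativity of `g ⋆ h`). [folklore] -/
theorem tsum_swap23 (f g h : Site d → ℝ≥0∞) (a : Site d) :
    ∑' xy : Site d × Site d, f xy.1 * h (xy.2 - xy.1) * g (a - xy.2) =
      ∑' xy : Site d × Site d, f xy.1 * g (xy.2 - xy.1) * h (a - xy.2) := by
  rw [ENNReal.tsum_prod', ENNReal.tsum_prod']
  refine tsum_congr fun x => ?_
  rw [tsum_reflect_shift _ (a + x)]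
  refine tsum_congr fun y => ?_
  rw [show a + x - y - x = a - y by abel, show a - (a + x - y) = y - x by abel]
  ring

/-- `Δ̃_{p_c}` is the `T`-form of `τ, τ̃`. [cite: HeydenreichVanDerHofstad2017, (7.2.2)–(7.2.4)] -/
theorem tForm_tau_tauTilde : tForm d (tauPcE d) (tauTildePcE d) = percTriTildeBar d := by
  refine iSup_congr fun a => ?_
  exact (tsum_swap23 (tauPcE d) (tauTildePcE d) (tauPcE d) a).symm

/-- `‖P_{f,g} ρ‖_{∞→∞} ≤ tForm f g` restated for `kRungR`. [cite: HeydenreichVanDerHofstad2017, (7.5.13)] -/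
theorem pkNormInf_kRungR_kProp_le (f g : Site d → ℝ≥0∞) (hg : ∀ v, g (-v) = g v) :
    pkNormInf (kRungR (kProp f g)) ≤ tForm d f g :=
  pkNormInf_kProp_rung_le f g hg

/-- `‖ρ P_{f,g}‖_{1→1} ≤ tForm f g` restated for `kRungL`. [cite: HeydenreichVanDerHofstad2017, Exercise 7.5] -/
theorem pkNormOne_kRungL_kProp_le (f g : Site d → ℝ≥0∞) (hf : ∀ v, f (-v) = f v) :
    pkNormOne (kRungL (kProp f g)) ≤ tForm d f g :=
  pkNormOne_rung_kProp_le f g hf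

/-- `‖P×_{τ,τ} ρ‖_{∞→∞} ≤ Δ_{p_c}` (the triangle `Σ_{w',u'} τ(w'-t) τ(u'-w') τ(u'-z)` of (7.5.13)).
[cite: HeydenreichVanDerHofstad2017, (7.5.13)] -/
theorem pkNormInf_kRungR_kPropX_le : pkNormInf (kRungR (kPropX (tauPcE d) (tauPcE d))) ≤ percTriBar d := by
  refine iSup_le fun p => ?_
  calc ∑' q : Site d × Site d, kRungR (kPropX (tauPcE d) (tauPcE d)) p q
      = ∑' q : Site d × Site d, tauPcE d (q.1 - p.2) * tauPcE d (q.2 - q.1) * tauPcE d (p.1 - q.2) := by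
        refine tsum_congr fun q => ?_
        simp only [kRungR, kPropX, tauPcE_sub_comm q.2 p.1]
        ring
    _ = percTri d (p.1 - p.2) := tsum_tau3_eq_percTri p.2 p.1
    _ ≤ percTriBar d := le_iSup (percTri d) _

/-- `‖ρ P×_{τ,τ}‖_{1→1} ≤ Δ_{p_c}`. [cite: HeydenreichVanDerHofstad2017, Exercise 7.5] -/
theorem pkNormOne_kRungL_kPropX_le : pkNormOne (kRungL (kPropX (tauPcE d) (tauPcE d))) ≤ percTriBar d := by
  refine iSup_le fun q => ?_
  calc ∑' p : Site d × Site d, kRungL (kPropX (tauPcE d) (tauPcE d)) p q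
      = ∑' p : Site d × Site d, tauPcE d (p.1 - q.2) * tauPcE d (p.2 - p.1) * tauPcE d (q.1 - p.2) := by
        refine tsum_congr fun p => ?_
        simp only [kRungL, kPropX, tauPcE_sub_comm q.2 p.1]
        ring
    _ = percTri d (q.1 - q.2) := tsum_tau3_eq_percTri q.2 q.1
    _ ≤ percTriBar d := le_iSup (percTri d) _

/-- The **weighted `B₂⁽²⁾`**: `B̃₂⁽²⁾^{(b,c)}((z,t),(w',u')) := |0|^c δ_{t,w'} Σ_a τ(a-w') τ(z-a) τ(u'-a) G^{(b)}(u'-z)`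
— weight `|·|^b` on the path line `τ(u'-z)`, weight `|·|^c` on the vanishing displacement `w' - t`
("with the understanding that the third [displacement] is constrained to vanish"); `b = c = 0` is
`B₂⁽²⁾`. [cite: HeydenreichVanDerHofstad2017, (7.4.4) and §7.5.2 (the vanishing displacement)]
[cite: Hara2008, §3.4 (Step 1)] -/
def kB2twoW (d : ℕ) (b c : ℝ) (p q : Site d × Site d) : ℝ≥0∞ :=
  wE c (0 : Site d) * if p.2 = q.1 then ∑' a : Site d,
    tauPcE d (a - q.1) * tauPcE d (p.1 - a) * tauPcE d (q.2 - a) * gE d b (q.2 - p.1) else 0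

/-- `B̃₂⁽²⁾^{(0,0)} = B₂⁽²⁾`. [folklore] -/
theorem kB2twoW_zero_zero : kB2twoW d 0 0 = kB2two d := by
  funext p q
  simp only [kB2twoW, kB2two, percB2two, wE_zero_exp, one_mul, gE_zero_exp]

/-- The **weighted open bubble** `(τ ⋆ G^{(b)})(x) = Σ_y τ(y) G^{(b)}(x - y)`. [cite: Hara2008, §1.1 (W^{(0,β)})] -/
def wBubble (d : ℕ) (b : ℝ) (x : Site d) : ℝ≥0∞ := ∑' y : Site d, tauPcE d y * gE d b (x - y)

/-- `Σ_y τ(y - a) G^{(b)}(z - y) = (τ ⋆ G^{(b)})(z - a)`. [folklore] -/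
theorem tsum_tau_gE_eq_wBubble (b : ℝ) (a z : Site d) :
    ∑' y : Site d, tauPcE d (y - a) * gE d b (z - y) = wBubble d b (z - a) :=
  tsum_series2 _ _ a z

/-- **Closing the weighted bubble by a line through the origin gives `T^{(0,b)}(0) ≤ T̄^{(0,b)}`**:
`Σ_a τ(a) (τ ⋆ G^{(b)})(a) ≤ T̄^{(0,b)}`. [cite: Hara2008, §1.1 (T^{(0,γ)})] -/
theorem tsum_tau_mul_wBubble_le (b : ℝ) : ∑' a : Site d, tauPcE d a * wBubble d b a ≤ haraTBar d 0 b := by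
  refine le_trans (le_of_eq ?_) (tsum_gE_gE_tau_le 0 b 0)
  calc ∑' a : Site d, tauPcE d a * wBubble d b a
      = ∑' a : Site d, ∑' y : Site d, gE d 0 y * gE d b (a - y) * tauPcE d (0 - a) := by
        refine tsum_congr fun a => ?_
        rw [wBubble, mul_comm, ← ENNReal.tsum_mul_right]
        refine tsum_congr fun y => ?_
        rw [gE_zero_exp, zero_sub, tauPcE_neg]
    _ = ∑' y : Site d, ∑' a : Site d, gE d 0 y * gE d b (a - y) * tauPcE d (0 - a) := ENNReal.tsum_comm
    _ = ∑' xy : Site d × Site d, gE d 0 xy.1 * gE d b (xy.2 - xy.1) * tauPcE d (0 - xy.2) :=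
        (ENNReal.tsum_prod (f := fun y a => gE d 0 y * gE d b (a - y) * tauPcE d (0 - a))).symm

/-- **The (weighted) `B₂⁽²⁾` term after a propagator** (the computation (7.5.14) with general lines
and a weight on the path line of `B₂⁽²⁾`):
`‖P_{f,g} B̃₂⁽²⁾^{(b,c)}‖_{∞→∞} ≤ |0|^c · T̄^{(0,b)} · ‖P_{f,g} ρ‖_{∞→∞}`.
[cite: HeydenreichVanDerHofstad2017, (7.5.14)] [cite: Hara2008, §3.4 (Step 2)] -/
theorem pkNormInf_kProp_kB2twoW_le (f g : Site d → ℝ≥0∞) (b c : ℝ) :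
    pkNormInf (pkMul (kProp f g) (kB2twoW d b c)) ≤
      wE c (0 : Site d) * haraTBar d 0 b * pkNormInf (kRungR (kProp f g)) := by
  refine iSup_le fun p => ?_
  obtain ⟨w, u⟩ := p
  calc ∑' q : Site d × Site d, pkMul (kProp f g) (kB2twoW d b c) (w, u) q
      = ∑' zt : Site d × Site d, kProp f g (w, u) zt * ∑' q : Site d × Site d, kB2twoW d b c zt q := by
        rw [show (∑' q : Site d × Site d, pkMul (kProp f g) (kB2twoW d b c) (w, u) q) =
          ∑' q : Site d × Site d, ∑' zt : Site d × Site d, kProp f g (w, u) zt * kB2twoW d b c zt q from rfl,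
          ENNReal.tsum_comm]
        exact tsum_congr fun zt => ENNReal.tsum_mul_left
    -- the sum of `B̃₂⁽²⁾(z,t,·,·)`: the delta, then the weighted bubble
    _ = ∑' zt : Site d × Site d, kProp f g (w, u) zt * (wE c (0 : Site d) * ∑' a : Site d,
          tauPcE d (a - zt.2) * tauPcE d (zt.1 - a) * wBubble d b (zt.1 - a)) := by
        refine tsum_congr fun zt => ?_
        congr 1
        calc ∑' q : Site d × Site d, kB2twoW d b c zt q
            = ∑' w' : Site d, ∑' u' : Site d, kB2twoW d b c zt (w', u') := ENNReal.tsum_prod'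
          _ = ∑' u' : Site d, wE c (0 : Site d) * ∑' a : Site d,
                tauPcE d (a - zt.2) * tauPcE d (zt.1 - a) * tauPcE d (u' - a) * gE d b (u' - zt.1) := by
              rw [tsum_eq_single zt.2]
              · simp [kB2twoW]
              · intro w' hw'; simp [kB2twoW, Ne.symm hw']
          _ = wE c (0 : Site d) * ∑' a : Site d, tauPcE d (a - zt.2) * tauPcE d (zt.1 - a) *
                ∑' u' : Site d, tauPcE d (u' - a) * gE d b (zt.1 - u') := by
              rw [ENNReal.tsum_mul_left, ENNReal.tsum_comm]
              congr 1
              refine tsum_congr fun a => ?_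
              rw [← ENNReal.tsum_mul_left]
              refine tsum_congr fun u' => ?_
              rw [gE_sub_comm b u' zt.1]
              ring
          _ = _ := by
              congr 1
              exact tsum_congr fun a => by rw [tsum_tau_gE_eq_wBubble]
    -- translation `a = z - a'`
    _ = ∑' zt : Site d × Site d, kProp f g (w, u) zt * (wE c (0 : Site d) * ∑' a : Site d,
          tauPcE d (zt.1 - a - zt.2) * (tauPcE d a * wBubble d b a)) := by
        refine tsum_congr fun zt => ?_
        congr 2
        rw [tsum_reflect_shift _ zt.1]
        refine tsum_congr fun a => ?_
        rw [show zt.1 - (zt.1 - a) = a by abel]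
        ring
    _ = wE c (0 : Site d) * ∑' a : Site d, tauPcE d a * wBubble d b a * ∑' zt : Site d × Site d,
          kProp f g (w, u) zt * tauPcE d (zt.1 - a - zt.2) := by
        calc ∑' zt : Site d × Site d, kProp f g (w, u) zt * (wE c (0 : Site d) * ∑' a : Site d,
              tauPcE d (zt.1 - a - zt.2) * (tauPcE d a * wBubble d b a))
            = ∑' zt : Site d × Site d, ∑' a : Site d, wE c (0 : Site d) *
                (tauPcE d a * wBubble d b a * (kProp f g (w, u) zt * tauPcE d (zt.1 - a - zt.2))) := by
              refine tsum_congr fun zt => ?_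
              rw [← ENNReal.tsum_mul_left, ← ENNReal.tsum_mul_left]
              exact tsum_congr fun a => by ring
          _ = _ := by
              rw [ENNReal.tsum_comm, ← ENNReal.tsum_mul_left]
              exact tsum_congr fun a => by rw [ENNReal.tsum_mul_left, ENNReal.tsum_mul_left]
    -- the inner sum is `Σ_q (P_{f,g} ρ)((w, u + a), q)`
    _ = wE c (0 : Site d) * ∑' a : Site d, tauPcE d a * wBubble d b a * ∑' zt : Site d × Site d,
          kRungR (kProp f g) (w, u + a) zt := by
        congr 1
        refine tsum_congr fun a => ?_
        congr 1
        rw [ENNReal.tsum_prod', ENNReal.tsum_prod']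
        refine tsum_congr fun z => ?_
        rw [tsum_shift_sub _ a]
        refine tsum_congr fun t => ?_
        simp only [kRungR, kProp]
        rw [show z - a - (t - a) = -(t - z) by abel, tauPcE_neg, show t - a - u = t - (u + a) by abel]
    _ ≤ wE c (0 : Site d) * ∑' a : Site d, tauPcE d a * wBubble d b a * pkNormInf (kRungR (kProp f g)) :=
        mul_le_mul' le_rfl (ENNReal.tsum_le_tsum fun a => mul_le_mul' le_rfl (tsum_le_pkNormInf _ _))
    _ ≤ wE c (0 : Site d) * haraTBar d 0 b * pkNormInf (kRungR (kProp f g)) := by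
        rw [ENNReal.tsum_mul_right, ← mul_assoc]
        exact mul_le_mul' (mul_le_mul' le_rfl (tsum_tau_mul_wBubble_le b)) le_rfl

/-- **The (weighted) `B₂⁽²⁾` term before a propagator** (the reversed computation, Exercise 7.5):
`‖B̃₂⁽²⁾^{(b,c)} P_{f,g}‖_{1→1} ≤ |0|^c · T̄^{(0,b)} · ‖ρ P_{f,g}‖_{1→1}`.
[cite: HeydenreichVanDerHofstad2017, Exercise 7.5] [cite: Hara2008, §3.4 (Step 2)] -/
theorem pkNormOne_kB2twoW_kProp_le (f g : Site d → ℝ≥0∞) (b c : ℝ) :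
    pkNormOne (pkMul (kB2twoW d b c) (kProp f g)) ≤
      wE c (0 : Site d) * haraTBar d 0 b * pkNormOne (kRungL (kProp f g)) := by
  refine iSup_le fun q => ?_
  obtain ⟨u, v⟩ := q
  calc ∑' p : Site d × Site d, pkMul (kB2twoW d b c) (kProp f g) p (u, v)
      = ∑' st : Site d × Site d, (∑' p : Site d × Site d, kB2twoW d b c p st) * kProp f g st (u, v) := by
        rw [show (∑' p : Site d × Site d, pkMul (kB2twoW d b c) (kProp f g) p (u, v)) =
          ∑' p : Site d × Site d, ∑' st : Site d × Site d, kB2twoW d b c p st * kProp f g st (u, v) from rfl,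
          ENNReal.tsum_comm]
        exact tsum_congr fun st => ENNReal.tsum_mul_right
    -- the sum of `B̃₂⁽²⁾(·,·,s,t)`: the delta, then the weighted bubble
    _ = ∑' st : Site d × Site d, (wE c (0 : Site d) * ∑' a : Site d,
          tauPcE d (a - st.1) * tauPcE d (st.2 - a) * wBubble d b (st.2 - a)) * kProp f g st (u, v) := by
        refine tsum_congr fun st => ?_
        congr 1
        calc ∑' p : Site d × Site d, kB2twoW d b c p st
            = ∑' x : Site d, ∑' y : Site d, kB2twoW d b c (x, y) st := ENNReal.tsum_prod'
          _ = ∑' x : Site d, wE c (0 : Site d) * ∑' a : Site d,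
                tauPcE d (a - st.1) * tauPcE d (x - a) * tauPcE d (st.2 - a) * gE d b (st.2 - x) := by
              refine tsum_congr fun x => ?_
              rw [tsum_eq_single st.1]
              · simp [kB2twoW]
              · intro y hy; simp [kB2twoW, hy]
          _ = wE c (0 : Site d) * ∑' a : Site d, tauPcE d (a - st.1) * tauPcE d (st.2 - a) *
                ∑' x : Site d, tauPcE d (x - a) * gE d b (st.2 - x) := by
              rw [ENNReal.tsum_mul_left, ENNReal.tsum_comm]
              congr 1
              refine tsum_congr fun a => ?_
              rw [← ENNReal.tsum_mul_left]
              refine tsum_congr fun x => ?_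
              ring
          _ = _ := by
              congr 1
              exact tsum_congr fun a => by rw [tsum_tau_gE_eq_wBubble]
    -- reflection `a = t - b'`
    _ = ∑' st : Site d × Site d, (wE c (0 : Site d) * ∑' b' : Site d,
          tauPcE d (st.2 - b' - st.1) * (tauPcE d b' * wBubble d b b')) * kProp f g st (u, v) := by
        refine tsum_congr fun st => ?_
        congr 2
        rw [tsum_reflect_shift _ st.2]
        refine tsum_congr fun b' => ?_
        rw [show st.2 - (st.2 - b') = b' by abel]
        ring
    _ = wE c (0 : Site d) * ∑' b' : Site d, tauPcE d b' * wBubble d b b' * ∑' st : Site d × Site d,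
          tauPcE d (st.2 - b' - st.1) * kProp f g st (u, v) := by
        calc ∑' st : Site d × Site d, (wE c (0 : Site d) * ∑' b' : Site d,
              tauPcE d (st.2 - b' - st.1) * (tauPcE d b' * wBubble d b b')) * kProp f g st (u, v)
            = ∑' st : Site d × Site d, ∑' b' : Site d, wE c (0 : Site d) *
                (tauPcE d b' * wBubble d b b' * (tauPcE d (st.2 - b' - st.1) * kProp f g st (u, v))) := by
              refine tsum_congr fun st => ?_
              rw [← ENNReal.tsum_mul_left, ← ENNReal.tsum_mul_right]
              exact tsum_congr fun b' => by ring
          _ = _ := by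
              rw [ENNReal.tsum_comm, ← ENNReal.tsum_mul_left]
              exact tsum_congr fun b' => by rw [ENNReal.tsum_mul_left, ENNReal.tsum_mul_left]
    -- the inner sum is `Σ_p (ρ P_{f,g})(p, (u, v - b'))`
    _ = wE c (0 : Site d) * ∑' b' : Site d, tauPcE d b' * wBubble d b b' * ∑' st : Site d × Site d,
          kRungL (kProp f g) st (u, v - b') := by
        congr 1
        refine tsum_congr fun b' => ?_
        congr 1
        rw [ENNReal.tsum_prod', ENNReal.tsum_prod']
        refine tsum_congr fun s => ?_
        conv_lhs => rw [tsum_shift _ b']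
        refine tsum_congr fun t => ?_
        simp only [kRungL, kProp]
        rw [show t + b' - b' - s = t - s by abel, show v - (t + b') = v - b' - t by abel]
    _ ≤ wE c (0 : Site d) * ∑' b' : Site d, tauPcE d b' * wBubble d b b' * pkNormOne (kRungL (kProp f g)) :=
        mul_le_mul' le_rfl (ENNReal.tsum_le_tsum fun b' => mul_le_mul' le_rfl (tsum_le_pkNormOne _ _))
    _ ≤ wE c (0 : Site d) * haraTBar d 0 b * pkNormOne (kRungL (kProp f g)) := by
        rw [ENNReal.tsum_mul_right, ← mul_assoc]
        exact mul_le_mul' (mul_le_mul' le_rfl (tsum_tau_mul_wBubble_le b)) le_rfl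

end Rungs

/-! ### The forms of shifted, summed and pivotal lines -/

section Forms

variable {d : ℕ}

/-- The `W`-form is monotone in the second line. [folklore] -/
theorem wForm_mono_right (f : Site d → ℝ≥0∞) {g₁ g₂ : Site d → ℝ≥0∞} (h : ∀ v, g₁ v ≤ g₂ v) :
    wForm f g₁ ≤ wForm f g₂ :=
  iSup_mono fun _ => ENNReal.tsum_le_tsum fun _ => mul_le_mul' le_rfl (h _)

/-- The `T`-form is monotone in the second line. [folklore] -/
theorem tForm_mono_right (f : Site d → ℝ≥0∞) {g₁ g₂ : Site d → ℝ≥0∞} (h : ∀ v, g₁ v ≤ g₂ v) :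
    tForm d f g₁ ≤ tForm d f g₂ :=
  iSup_mono fun _ => ENNReal.tsum_le_tsum fun _ => mul_le_mul' (mul_le_mul' le_rfl (h _)) le_rfl

/-- The `W`-form is subadditive in the second line. [folklore] -/
theorem wForm_add_right (f g₁ g₂ : Site d → ℝ≥0∞) :
    wForm f (fun v => g₁ v + g₂ v) ≤ wForm f g₁ + wForm f g₂ := by
  refine iSup_le fun a => ?_
  calc ∑' y : Site d, f y * (g₁ (a - y) + g₂ (a - y))
      = (∑' y : Site d, f y * g₁ (a - y)) + ∑' y : Site d, f y * g₂ (a - y) := by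
        rw [← ENNReal.tsum_add]
        exact tsum_congr fun y => mul_add _ _ _
    _ ≤ wForm f g₁ + wForm f g₂ := add_le_add (tsum_le_wForm f g₁ a) (tsum_le_wForm f g₂ a)

/-- The `T`-form is subadditive in the second line. [folklore] -/
theorem tForm_add_right (f g₁ g₂ : Site d → ℝ≥0∞) :
    tForm d f (fun v => g₁ v + g₂ v) ≤ tForm d f g₁ + tForm d f g₂ := by
  refine iSup_le fun a => ?_
  calc ∑' xy : Site d × Site d, f xy.1 * (g₁ (xy.2 - xy.1) + g₂ (xy.2 - xy.1)) * tauPcE d (a - xy.2)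
      = (∑' xy : Site d × Site d, f xy.1 * g₁ (xy.2 - xy.1) * tauPcE d (a - xy.2)) +
          ∑' xy : Site d × Site d, f xy.1 * g₂ (xy.2 - xy.1) * tauPcE d (a - xy.2) := by
        rw [← ENNReal.tsum_add]
        exact tsum_congr fun xy => by ring
    _ ≤ tForm d f g₁ + tForm d f g₂ := add_le_add (tsum_le_tForm f g₁ a) (tsum_le_tForm f g₂ a)

/-- Constants come out of the `W`-form. [folklore] -/
theorem wForm_const_mul_right (f g : Site d → ℝ≥0∞) (k : ℝ≥0∞) :
    wForm f (fun v => k * g v) = k * wForm f g := by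
  rw [wForm, wForm, ENNReal.mul_iSup]
  refine iSup_congr fun a => ?_
  rw [← ENNReal.tsum_mul_left]
  exact tsum_congr fun y => by ring

/-- Constants come out of the `T`-form. [folklore] -/
theorem tForm_const_mul_right (f g : Site d → ℝ≥0∞) (k : ℝ≥0∞) :
    tForm d f (fun v => k * g v) = k * tForm d f g := by
  rw [tForm, tForm, ENNReal.mul_iSup]
  refine iSup_congr fun a => ?_
  rw [← ENNReal.tsum_mul_left]
  exact tsum_congr fun xy => by ring

/-- Shifting the second line does not increase the `W`-form. [folklore] -/
theorem wForm_shift_sub_le (f g : Site d → ℝ≥0∞) (e : Site d) :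
    wForm f (fun v => g (v - e)) ≤ wForm f g := by
  refine iSup_le fun a => le_trans (le_of_eq (tsum_congr fun y => ?_)) (tsum_le_wForm f g (a - e))
  rw [sub_right_comm]

/-- Shifting the second line does not increase the `W`-form. [folklore] -/
theorem wForm_shift_add_le (f g : Site d → ℝ≥0∞) (e : Site d) :
    wForm f (fun v => g (v + e)) ≤ wForm f g := by
  refine iSup_le fun a => le_trans (le_of_eq (tsum_congr fun y => ?_)) (tsum_le_wForm f g (a + e))
  dsimp only
  rw [show a - y + e = a + e - y by abel]

/-- Shifting the second line does not increase the `T`-form. [folklore] -/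
theorem tForm_shift_sub_le (f g : Site d → ℝ≥0∞) (e : Site d) :
    tForm d f (fun v => g (v - e)) ≤ tForm d f g := by
  refine iSup_le fun a => le_trans (le_of_eq ?_) (tsum_le_tForm f g (a - e))
  rw [ENNReal.tsum_prod', ENNReal.tsum_prod']
  refine tsum_congr fun x => ?_
  rw [tsum_shift _ e]
  refine tsum_congr fun y => ?_
  dsimp only
  rw [show y + e - x - e = y - x by abel, show a - (y + e) = a - e - y by abel]

/-- Shifting the second line does not increase the `T`-form. [folklore] -/
theorem tForm_shift_add_le (f g : Site d → ℝ≥0∞) (e : Site d) :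
    tForm d f (fun v => g (v + e)) ≤ tForm d f g := by
  refine iSup_le fun a => le_trans (le_of_eq ?_) (tsum_le_tForm f g (a + e))
  rw [ENNReal.tsum_prod', ENNReal.tsum_prod']
  refine tsum_congr fun x => ?_
  rw [tsum_shift_sub _ e]
  refine tsum_congr fun y => ?_
  dsimp only
  rw [show y - e - x + e = y - x by abel, show a - (y - e) = a + e - y by abel]

/-- The `W`-form of a finite sum of second lines. [folklore] -/
theorem wForm_finset_sum_right {ι : Type*} (f : Site d → ℝ≥0∞) (s : Finset ι) (g : ι → Site d → ℝ≥0∞) :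
    wForm f (fun v => ∑ i ∈ s, g i v) ≤ ∑ i ∈ s, wForm f (g i) := by
  refine iSup_le fun a => ?_
  calc ∑' y : Site d, f y * ∑ i ∈ s, g i (a - y) = ∑' y : Site d, ∑ i ∈ s, f y * g i (a - y) :=
        tsum_congr fun y => Finset.mul_sum _ _ _
    _ = ∑ i ∈ s, ∑' y : Site d, f y * g i (a - y) := Summable.tsum_finsetSum fun _ _ => ENNReal.summable
    _ ≤ ∑ i ∈ s, wForm f (g i) := Finset.sum_le_sum fun i _ => tsum_le_wForm f (g i) a

/-- The `T`-form of a finite sum of second lines. [folklore] -/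
theorem tForm_finset_sum_right {ι : Type*} (f : Site d → ℝ≥0∞) (s : Finset ι) (g : ι → Site d → ℝ≥0∞) :
    tForm d f (fun v => ∑ i ∈ s, g i v) ≤ ∑ i ∈ s, tForm d f (g i) := by
  refine iSup_le fun a => ?_
  calc ∑' xy : Site d × Site d, f xy.1 * (∑ i ∈ s, g i (xy.2 - xy.1)) * tauPcE d (a - xy.2)
      = ∑' xy : Site d × Site d, ∑ i ∈ s, f xy.1 * g i (xy.2 - xy.1) * tauPcE d (a - xy.2) :=
        tsum_congr fun xy => by rw [Finset.mul_sum, Finset.sum_mul]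
    _ = ∑ i ∈ s, ∑' xy : Site d × Site d, f xy.1 * g i (xy.2 - xy.1) * tauPcE d (a - xy.2) :=
        Summable.tsum_finsetSum fun _ _ => ENNReal.summable
    _ ≤ ∑ i ∈ s, tForm d f (g i) := Finset.sum_le_sum fun i _ => tsum_le_tForm f (g i) a

/-- **`W`-form of a pivotal line**: `wForm f G̃^{(c)} ≤ 2^c · 2d · (wForm f G^{(c)} + wForm f τ)`
(`c ≥ 0`, `p_c ≤ 1`). [cite: Hara2008, §3.4 (the pivotal line, (1 + c₄λ)-comparison)] -/
theorem wForm_gTildeE_le (f : Site d → ℝ≥0∞) {c : ℝ} (hc : 0 ≤ c) :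
    wForm f (gTildeE d c) ≤ ENNReal.ofReal (2 ^ c) * (2 * d) * (wForm f (gE d c) + wForm f (tauPcE d)) := by
  set K : ℝ≥0∞ := ENNReal.ofReal (2 ^ c) * ENNReal.ofReal (criticalProbI d) with hK
  calc wForm f (gTildeE d c)
      ≤ wForm f (fun v => K * ∑ i : Fin d, (gE d c (v - Pi.single i 1) + tauPcE d (v - Pi.single i 1) +
          (gE d c (v + Pi.single i 1) + tauPcE d (v + Pi.single i 1)))) :=
        wForm_mono_right f fun v => gTildeE_le hc v
    _ = K * wForm f (fun v => ∑ i : Fin d, (gE d c (v - Pi.single i 1) + tauPcE d (v - Pi.single i 1) +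
          (gE d c (v + Pi.single i 1) + tauPcE d (v + Pi.single i 1)))) := wForm_const_mul_right _ _ _
    _ ≤ K * ∑ i : Fin d, wForm f (fun v => gE d c (v - Pi.single i 1) + tauPcE d (v - Pi.single i 1) +
          (gE d c (v + Pi.single i 1) + tauPcE d (v + Pi.single i 1))) :=
        mul_le_mul' le_rfl (wForm_finset_sum_right f _ _)
    _ ≤ K * ∑ _i : Fin d, 2 * (wForm f (gE d c) + wForm f (tauPcE d)) := by
        refine mul_le_mul' le_rfl (Finset.sum_le_sum fun i _ => ?_)
        refine (wForm_add_right f _ _).trans ?_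
        rw [two_mul]
        refine add_le_add ((wForm_add_right f _ _).trans (add_le_add ?_ ?_))
          ((wForm_add_right f _ _).trans (add_le_add ?_ ?_))
        · exact wForm_shift_sub_le f (gE d c) _
        · exact wForm_shift_sub_le f (tauPcE d) _
        · exact wForm_shift_add_le f (gE d c) _
        · exact wForm_shift_add_le f (tauPcE d) _
    _ = K * (d * (2 * (wForm f (gE d c) + wForm f (tauPcE d)))) := by
        rw [Finset.sum_const, Finset.card_univ, Fintype.card_fin, nsmul_eq_mul]
    _ ≤ ENNReal.ofReal (2 ^ c) * 1 * (d * (2 * (wForm f (gE d c) + wForm f (tauPcE d)))) :=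
        mul_le_mul' (mul_le_mul' le_rfl ofReal_criticalProbI_le_one) le_rfl
    _ = ENNReal.ofReal (2 ^ c) * (2 * d) * (wForm f (gE d c) + wForm f (tauPcE d)) := by ring

/-- **`T`-form of a pivotal line**: `tForm f G̃^{(c)} ≤ 2^c · 2d · (tForm f G^{(c)} + tForm f τ)`.
[cite: Hara2008, §3.4 (the pivotal line; "we get … (1+c₄λ)[T̄^{(0,γ)} + 1/2d]")] -/
theorem tForm_gTildeE_le (f : Site d → ℝ≥0∞) {c : ℝ} (hc : 0 ≤ c) :
    tForm d f (gTildeE d c) ≤ ENNReal.ofReal (2 ^ c) * (2 * d) * (tForm d f (gE d c) + tForm d f (tauPcE d)) := by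
  set K : ℝ≥0∞ := ENNReal.ofReal (2 ^ c) * ENNReal.ofReal (criticalProbI d) with hK
  calc tForm d f (gTildeE d c)
      ≤ tForm d f (fun v => K * ∑ i : Fin d, (gE d c (v - Pi.single i 1) + tauPcE d (v - Pi.single i 1) +
          (gE d c (v + Pi.single i 1) + tauPcE d (v + Pi.single i 1)))) :=
        tForm_mono_right f fun v => gTildeE_le hc v
    _ = K * tForm d f (fun v => ∑ i : Fin d, (gE d c (v - Pi.single i 1) + tauPcE d (v - Pi.single i 1) +
          (gE d c (v + Pi.single i 1) + tauPcE d (v + Pi.single i 1)))) := tForm_const_mul_right _ _ _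
    _ ≤ K * ∑ i : Fin d, tForm d f (fun v => gE d c (v - Pi.single i 1) + tauPcE d (v - Pi.single i 1) +
          (gE d c (v + Pi.single i 1) + tauPcE d (v + Pi.single i 1))) :=
        mul_le_mul' le_rfl (tForm_finset_sum_right f _ _)
    _ ≤ K * ∑ _i : Fin d, 2 * (tForm d f (gE d c) + tForm d f (tauPcE d)) := by
        refine mul_le_mul' le_rfl (Finset.sum_le_sum fun i _ => ?_)
        refine (tForm_add_right f _ _).trans ?_
        rw [two_mul]
        refine add_le_add ((tForm_add_right f _ _).trans (add_le_add ?_ ?_))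
          ((tForm_add_right f _ _).trans (add_le_add ?_ ?_))
        · exact tForm_shift_sub_le f (gE d c) _
        · exact tForm_shift_sub_le f (tauPcE d) _
        · exact tForm_shift_add_le f (gE d c) _
        · exact tForm_shift_add_le f (tauPcE d) _
    _ = K * (d * (2 * (tForm d f (gE d c) + tForm d f (tauPcE d)))) := by
        rw [Finset.sum_const, Finset.card_univ, Fintype.card_fin, nsmul_eq_mul]
    _ ≤ ENNReal.ofReal (2 ^ c) * 1 * (d * (2 * (tForm d f (gE d c) + tForm d f (tauPcE d)))) :=
        mul_le_mul' (mul_le_mul' le_rfl ofReal_criticalProbI_le_one) le_rfl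
    _ = ENNReal.ofReal (2 ^ c) * (2 * d) * (tForm d f (gE d c) + tForm d f (tauPcE d)) := by ring

/-- `wForm G^{(b)} τ = W̄^{(b,0)}`. [cite: Hara2008, §1.1] -/
theorem wForm_gE_tau (b : ℝ) : wForm (gE d b) (tauPcE d) = haraWBar d b 0 := by
  rw [haraWBar_eq_wForm]
  congr 1
  funext v
  exact (gE_zero_exp v).symm

/-- `tForm G^{(b)} τ = T̄^{(b,0)}`. [cite: Hara2008, §1.1] -/
theorem tForm_gE_tau (b : ℝ) : tForm d (gE d b) (tauPcE d) = haraTBar d b 0 := by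
  rw [haraTBar_eq_tForm]
  congr 1
  funext v
  exact (gE_zero_exp v).symm

/-- `G̃^{(c)}` is even. [folklore] -/
theorem gTildeE_neg (c : ℝ) (v : Site d) : gTildeE d c (-v) = gTildeE d c v := by
  rw [gTildeE, gTildeE, wE_neg, tauTildePcE_neg]

end Forms

/-! ### The piece estimates for weighted `B₁`-factors -/

section Pieces

variable {d : ℕ}

/-- The constant `2^c · 2d` of the pivotal-line comparison. [cite: Hara2008, §3.4] -/
def pivC (d : ℕ) (c : ℝ) : ℝ≥0∞ := ENNReal.ofReal (2 ^ c) * (2 * d)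

/-- **The mixed norm of a weighted `B₁`** (Hara's `W̄`-peeling, incl. case (b-2) `W^{(β,γ)}` and the
left factor `W^{(β,0)}` of case (b-3)): `‖B̃₁^{(b,c)}‖_mix ≤ 2^c 2d (W̄^{(b,c)} + W̄^{(b,0)})`, `c ≥ 0`.
[cite: Hara2008, §3.4 (Step 2, cases (b-2), (b-3))] -/
theorem pkNormMix_kB1w_le (b : ℝ) {c : ℝ} (hc : 0 ≤ c) :
    pkNormMix (kB1w d b c) ≤ pivC d c * (haraWBar d b c + haraWBar d b 0) := by
  refine (pkNormMix_kProp_le _ _ (gTildeE_neg c)).trans ((wForm_gTildeE_le _ hc).trans (le_of_eq ?_))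
  rw [pivC, ← haraWBar_eq_wForm, wForm_gE_tau]

/-- **A weighted `B₁` closed by a rung on the right is a weighted open triangle**:
`‖B̃₁^{(b,c)} ρ‖_{∞→∞} ≤ 2^c 2d (T̄^{(b,c)} + T̄^{(b,0)})`, `c ≥ 0`.
[cite: Hara2008, §3.4 (Step 2: "the right factor … bounded by the product of a triangle and T^{(0,γ)}")] -/
theorem pkNormInf_kRungR_kB1w_le (b : ℝ) {c : ℝ} (hc : 0 ≤ c) :
    pkNormInf (kRungR (kB1w d b c)) ≤ pivC d c * (haraTBar d b c + haraTBar d b 0) := by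
  refine (pkNormInf_kRungR_kProp_le _ _ (gTildeE_neg c)).trans ((tForm_gTildeE_le _ hc).trans (le_of_eq ?_))
  rw [pivC, ← haraTBar_eq_tForm, tForm_gE_tau]

/-- **A weighted `B₁` closed by a rung on the left**: `‖ρ B̃₁^{(b,c)}‖_{1→1} ≤ 2^c 2d (T̄^{(b,c)} + T̄^{(b,0)})`.
[cite: Hara2008, §3.4 (Step 2)] -/
theorem pkNormOne_kRungL_kB1w_le (b : ℝ) {c : ℝ} (hc : 0 ≤ c) :
    pkNormOne (kRungL (kB1w d b c)) ≤ pivC d c * (haraTBar d b c + haraTBar d b 0) := by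
  refine (pkNormOne_kRungL_kProp_le _ _ (gE_neg b)).trans ((tForm_gTildeE_le _ hc).trans (le_of_eq ?_))
  rw [pivC, ← haraTBar_eq_tForm, tForm_gE_tau]

/-- `‖B₁ ρ‖_{∞→∞} ≤ Δ̃_{p_c}` (the open triangle with a pivotal line, (7.5.13)).
[cite: HeydenreichVanDerHofstad2017, (7.5.13)] -/
theorem pkNormInf_kRungR_kB1_le : pkNormInf (kRungR (kB1 d)) ≤ percTriTildeBar d := by
  rw [kB1_eq_kProp, ← tForm_tau_tauTilde]
  exact pkNormInf_kRungR_kProp_le _ _ tauTildePcE_neg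

/-- `‖ρ B₁‖_{1→1} ≤ Δ̃_{p_c}`. [cite: HeydenreichVanDerHofstad2017, Exercise 7.5] -/
theorem pkNormOne_kRungL_kB1_le : pkNormOne (kRungL (kB1 d)) ≤ percTriTildeBar d := by
  rw [kB1_eq_kProp, ← tForm_tau_tauTilde]
  exact pkNormOne_kRungL_kProp_le _ _ tauPcE_neg

/-- **A propagator followed by `B₂`** (both terms): `‖P_{f,g} B₂‖_{∞→∞} ≤ 2 Δ_{p_c} ‖P_{f,g} ρ‖_{∞→∞}`.
[cite: HeydenreichVanDerHofstad2017, (7.5.12)–(7.5.14)] -/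
theorem pkNormInf_kProp_kB2_le (f g : Site d → ℝ≥0∞) :
    pkNormInf (pkMul (kProp f g) (kB2 d)) ≤ 2 * percTriBar d * pkNormInf (kRungR (kProp f g)) := by
  rw [kB2_eq_add, pkMul_add_right]
  refine (pkNormInf_add_le _ _).trans ?_
  rw [two_mul, add_mul]
  refine add_le_add ?_ ?_
  · rw [kB2one_eq, ← pkMul_kRungR]
    calc pkNormInf (pkMul (kRungR (kProp f g)) (kRungR (kPropX (tauPcE d) (tauPcE d))))
        ≤ pkNormInf (kRungR (kProp f g)) * pkNormInf (kRungR (kPropX (tauPcE d) (tauPcE d))) :=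
          pkNormInf_pkMul_le _ _
      _ ≤ pkNormInf (kRungR (kProp f g)) * percTriBar d := mul_le_mul' le_rfl pkNormInf_kRungR_kPropX_le
      _ = percTriBar d * pkNormInf (kRungR (kProp f g)) := mul_comm _ _
  · have h := pkNormInf_kProp_kB2twoW_le (d := d) f g 0 0
    rw [kB2twoW_zero_zero, wE_zero_exp, one_mul, haraTBar_eq_tForm,
      show gE d 0 = tauPcE d from funext gE_zero_exp, tForm_tau_tau] at h
    exact h

/-- **`B₂` followed by a propagator** (both terms): `‖B₂ P_{f,g}‖_{1→1} ≤ 2 Δ_{p_c} ‖ρ P_{f,g}‖_{1→1}`.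
[cite: HeydenreichVanDerHofstad2017, Exercise 7.5] -/
theorem pkNormOne_kB2_kProp_le (f g : Site d → ℝ≥0∞) :
    pkNormOne (pkMul (kB2 d) (kProp f g)) ≤ 2 * percTriBar d * pkNormOne (kRungL (kProp f g)) := by
  rw [kB2_eq_add, pkMul_add_left]
  refine (pkNormOne_add_le _ _).trans ?_
  rw [two_mul, add_mul]
  refine add_le_add ?_ ?_
  · rw [kB2one_eq, ← kRungL_pkMul, pkMul_kRungR, kRungL_pkMul]
    calc pkNormOne (pkMul (kRungL (kPropX (tauPcE d) (tauPcE d))) (kRungL (kProp f g)))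
        ≤ pkNormOne (kRungL (kPropX (tauPcE d) (tauPcE d))) * pkNormOne (kRungL (kProp f g)) :=
          pkNormOne_pkMul_le _ _
      _ ≤ percTriBar d * pkNormOne (kRungL (kProp f g)) := mul_le_mul' pkNormOne_kRungL_kPropX_le le_rfl
  · have h := pkNormOne_kB2twoW_kProp_le (d := d) f g 0 0
    rw [kB2twoW_zero_zero, wE_zero_exp, one_mul, haraTBar_eq_tForm,
      show gE d 0 = tauPcE d from funext gE_zero_exp, tForm_tau_tau] at h
    exact h

/-- **The block `B̃₁^{(b,c)} B₂` in `‖·‖_{∞→∞}`** (Hara's "triangle × `T^{(0,γ)}`" for the `γ`-part;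
`c ≥ 0`): `≤ 2Δ_{p_c} · 2^c 2d (T̄^{(b,c)} + T̄^{(b,0)})`. [cite: Hara2008, §3.4 (Step 2, case (b-3))] -/
theorem pkNormInf_kB1w_kB2_le (b : ℝ) {c : ℝ} (hc : 0 ≤ c) :
    pkNormInf (pkMul (kB1w d b c) (kB2 d)) ≤ 2 * percTriBar d * (pivC d c * (haraTBar d b c + haraTBar d b 0)) :=
  (pkNormInf_kProp_kB2_le _ _).trans (mul_le_mul' le_rfl (pkNormInf_kRungR_kB1w_le b hc))

/-- **The block `B₂ B̃₁^{(b,c)}` in `‖·‖_{1→1}`**: `≤ 2Δ_{p_c} · 2^c 2d (T̄^{(b,c)} + T̄^{(b,0)})`.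
[cite: Hara2008, §3.4 (Step 2, case (b-3))] -/
theorem pkNormOne_kB2_kB1w_le (b : ℝ) {c : ℝ} (hc : 0 ≤ c) :
    pkNormOne (pkMul (kB2 d) (kB1w d b c)) ≤ 2 * percTriBar d * (pivC d c * (haraTBar d b c + haraTBar d b 0)) :=
  (pkNormOne_kB2_kProp_le _ _).trans (mul_le_mul' le_rfl (pkNormOne_kRungL_kB1w_le b hc))

/-- `‖B₁ B₂‖_{∞→∞} ≤ 2 Δ̃_{p_c} Δ_{p_c}` recovered from the propagator calculus (consistency with
`pkNormInf_kB1_kB2_le`). [cite: HeydenreichVanDerHofstad2017, (7.5.12)] -/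
theorem pkNormInf_kB1_kB2_le' : pkNormInf (pkMul (kB1 d) (kB2 d)) ≤ 2 * percTriBar d * percTriTildeBar d := by
  have h := pkNormInf_kProp_kB2_le (d := d) (tauPcE d) (tauTildePcE d)
  rw [← kB1_eq_kProp] at h
  exact h.trans (mul_le_mul' le_rfl pkNormInf_kRungR_kB1_le)

/-- **The weighted `B₂⁽¹⁾`**: `B̃₂⁽¹⁾^{(b,c)} := ρ P×_{G^{(b)},G^{(c)}} ρ'` (weight `|·|^b` on the line
`τ(u'-z)`, `|·|^c` on `τ(w'-t)`). [cite: Hara2008, §3.4 (Step 1)] -/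
def kB2oneW (d : ℕ) (b c : ℝ) : Site d × Site d → Site d × Site d → ℝ≥0∞ :=
  kRungL (kRungR (kPropX (gE d b) (gE d c)))

/-- `B̃₂⁽¹⁾^{(0,0)} = B₂⁽¹⁾`. [folklore] -/
theorem kB2oneW_zero_zero : kB2oneW d 0 0 = kB2one d := by
  rw [kB2oneW, kB2one_eq]
  congr 3 <;> funext v <;> exact gE_zero_exp v

/-- **A weighted `B₂⁽¹⁾` in the middle**: `‖X B̃₂⁽¹⁾^{(b,c)} Y‖_mix ≤ ‖Xρ‖_{∞→∞} W̄^{(b,c)} ‖ρ'Y‖_{1→1}`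
for translation-invariant `Y` (both weights inside one `B₂⁽¹⁾`: Hara's facing lines, case (b-2);
one weight: the analogue of (7.5.29)). [cite: Hara2008, §3.4 (Step 2, case (b-2))]
[cite: HeydenreichVanDerHofstad2017, (7.5.29)] -/
theorem pkNormMix_mid_kB2oneW_le (X Y : Site d × Site d → Site d × Site d → ℝ≥0∞) (hY : PkTI Y) (b c : ℝ) :
    pkNormMix (pkMul X (pkMul (kB2oneW d b c) Y)) ≤
      pkNormInf (kRungR X) * haraWBar d b c * pkNormOne (kRungL Y) := by
  rw [kB2oneW, ← kRungL_pkMul, ← pkMul_kRungR, pkMul_kRungR (kPropX _ _)]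
  calc pkNormMix (pkMul (kRungR X) (pkMul (kPropX (gE d b) (gE d c)) (kRungL Y)))
      ≤ pkNormInf (kRungR X) * pkNormMix (pkMul (kPropX (gE d b) (gE d c)) (kRungL Y)) :=
        pkNormMix_pkMul_le _ _
    _ ≤ pkNormInf (kRungR X) * (pkNormMix (kPropX (gE d b) (gE d c)) * pkNormOne (kRungL Y)) :=
        mul_le_mul' le_rfl (pkNormMix_pkMul_le' _ _ (pkTI_kRungL hY))
    _ ≤ pkNormInf (kRungR X) * (haraWBar d b c * pkNormOne (kRungL Y)) := by
        refine mul_le_mul' le_rfl (mul_le_mul' ?_ le_rfl)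
        rw [haraWBar_eq_wForm]
        exact pkNormMix_kPropX_le _ _ (gE_neg c)
    _ = _ := by rw [mul_assoc]

end Pieces

/-! ### Weighted `B₂` (both terms), and the lines out of `0` and into `x` -/

section MorePieces

variable {d : ℕ}

/-- `‖P×_{G^{(b)},G^{(c)}} ρ‖_{∞→∞} ≤ T̄^{(b,c)}` (a weighted open triangle).
[cite: Hara2008, §3.4 (Step 2: "decompose the middle part into triangles")] -/
theorem pkNormInf_kRungR_kPropX_gE_le (b c : ℝ) :
    pkNormInf (kRungR (kPropX (gE d b) (gE d c))) ≤ haraTBar d b c := by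
  refine iSup_le fun p => ?_
  calc ∑' q : Site d × Site d, kRungR (kPropX (gE d b) (gE d c)) p q
      = ∑' q : Site d × Site d, gE d c (q.1 - p.2) * tauPcE d (q.2 - q.1) * gE d b (p.1 - q.2) := by
        refine tsum_congr fun q => ?_
        simp only [kRungR, kPropX, gE_sub_comm b q.2 p.1]
        ring
    _ = ∑' q : Site d × Site d, gE d c q.1 * tauPcE d (q.2 - q.1) * gE d b (p.1 - p.2 - q.2) :=
        tsum_series3 _ _ _ p.2 p.1
    _ = ∑' q : Site d × Site d, gE d c q.1 * gE d b (q.2 - q.1) * tauPcE d (p.1 - p.2 - q.2) :=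
        tsum_swap23 _ _ _ _
    _ ≤ haraTBar d c b := tsum_gE_gE_tau_le c b _
    _ = haraTBar d b c := haraTBar_comm c b

/-- `‖ρ P×_{G^{(b)},G^{(c)}}‖_{1→1} ≤ T̄^{(b,c)}`. [cite: Hara2008, §3.4 (Step 2)] -/
theorem pkNormOne_kRungL_kPropX_gE_le (b c : ℝ) :
    pkNormOne (kRungL (kPropX (gE d b) (gE d c))) ≤ haraTBar d b c := by
  refine iSup_le fun q => ?_
  calc ∑' p : Site d × Site d, kRungL (kPropX (gE d b) (gE d c)) p q
      = ∑' p : Site d × Site d, gE d b (p.1 - q.2) * tauPcE d (p.2 - p.1) * gE d c (q.1 - p.2) := by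
        refine tsum_congr fun p => ?_
        simp only [kRungL, kPropX, gE_sub_comm b q.2 p.1]
        ring
    _ = ∑' p : Site d × Site d, gE d b p.1 * tauPcE d (p.2 - p.1) * gE d c (q.1 - q.2 - p.2) :=
        tsum_series3 _ _ _ q.2 q.1
    _ = ∑' p : Site d × Site d, gE d b p.1 * gE d c (p.2 - p.1) * tauPcE d (q.1 - q.2 - p.2) :=
        tsum_swap23 _ _ _ _
    _ ≤ haraTBar d b c := tsum_gE_gE_tau_le b c _

/-- The **weighted `B₂`**: `B̃₂^{(b,c)} := B̃₂⁽¹⁾^{(b,c)} + B̃₂⁽²⁾^{(b,c)}` (weight `|·|^b` on the path line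
`z → u'`, `|·|^c` on the path line `t → w'`). [cite: Hara2008, §3.4 (Step 1)]
[cite: HeydenreichVanDerHofstad2017, (7.4.4)] -/
def kB2W (d : ℕ) (b c : ℝ) (p q : Site d × Site d) : ℝ≥0∞ := kB2oneW d b c p q + kB2twoW d b c p q

/-- `B̃₂^{(0,0)} = B₂`. [folklore] -/
theorem kB2W_zero_zero : kB2W d 0 0 = kB2 d := by
  funext p q
  rw [kB2W, kB2oneW_zero_zero, kB2twoW_zero_zero, kB2_eq_add]

/-- **A propagator followed by a weighted `B₂`**:
`‖P_{f,g} B̃₂^{(b,c)}‖_{∞→∞} ≤ (T̄^{(b,c)} + |0|^c T̄^{(0,b)}) ‖P_{f,g} ρ‖_{∞→∞}`.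
[cite: Hara2008, §3.4 (Step 2)] [cite: HeydenreichVanDerHofstad2017, (7.5.13)–(7.5.14)] -/
theorem pkNormInf_kProp_kB2W_le (f g : Site d → ℝ≥0∞) (b c : ℝ) :
    pkNormInf (pkMul (kProp f g) (kB2W d b c)) ≤
      (haraTBar d b c + wE c (0 : Site d) * haraTBar d 0 b) * pkNormInf (kRungR (kProp f g)) := by
  rw [show kB2W d b c = fun p q => kB2oneW d b c p q + kB2twoW d b c p q from rfl, pkMul_add_right]
  refine (pkNormInf_add_le _ _).trans ?_
  rw [add_mul]
  refine add_le_add ?_ ?_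
  · rw [kB2oneW, ← pkMul_kRungR]
    calc pkNormInf (pkMul (kRungR (kProp f g)) (kRungR (kPropX (gE d b) (gE d c))))
        ≤ pkNormInf (kRungR (kProp f g)) * pkNormInf (kRungR (kPropX (gE d b) (gE d c))) :=
          pkNormInf_pkMul_le _ _
      _ ≤ pkNormInf (kRungR (kProp f g)) * haraTBar d b c := mul_le_mul' le_rfl (pkNormInf_kRungR_kPropX_gE_le b c)
      _ = haraTBar d b c * pkNormInf (kRungR (kProp f g)) := mul_comm _ _
  · exact pkNormInf_kProp_kB2twoW_le f g b c

/-- **A weighted `B₂` followed by a propagator**: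
`‖B̃₂^{(b,c)} P_{f,g}‖_{1→1} ≤ (T̄^{(b,c)} + |0|^c T̄^{(0,b)}) ‖ρ P_{f,g}‖_{1→1}`.
[cite: Hara2008, §3.4 (Step 2)] [cite: HeydenreichVanDerHofstad2017, Exercise 7.5] -/
theorem pkNormOne_kB2W_kProp_le (f g : Site d → ℝ≥0∞) (b c : ℝ) :
    pkNormOne (pkMul (kB2W d b c) (kProp f g)) ≤
      (haraTBar d b c + wE c (0 : Site d) * haraTBar d 0 b) * pkNormOne (kRungL (kProp f g)) := by
  rw [show kB2W d b c = fun p q => kB2oneW d b c p q + kB2twoW d b c p q from rfl, pkMul_add_left]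
  refine (pkNormOne_add_le _ _).trans ?_
  rw [add_mul]
  refine add_le_add ?_ ?_
  · rw [kB2oneW, ← kRungL_pkMul, pkMul_kRungR, kRungL_pkMul]
    calc pkNormOne (pkMul (kRungL (kPropX (gE d b) (gE d c))) (kRungL (kProp f g)))
        ≤ pkNormOne (kRungL (kPropX (gE d b) (gE d c))) * pkNormOne (kRungL (kProp f g)) :=
          pkNormOne_pkMul_le _ _
      _ ≤ haraTBar d b c * pkNormOne (kRungL (kProp f g)) := mul_le_mul' (pkNormOne_kRungL_kPropX_gE_le b c) le_rfl
  · exact pkNormOne_kB2twoW_kProp_le f g b c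

/-- Translation invariance of the weighted kernels. [folklore] -/
theorem pkTI_kB1w (b c : ℝ) : PkTI (kB1w d b c) := pkTI_kProp _ _

/-- `B̃₂⁽¹⁾` is translation invariant. [folklore] -/
theorem pkTI_kB2oneW (b c : ℝ) : PkTI (kB2oneW d b c) := pkTI_kRungL (pkTI_kRungR (pkTI_kPropX _ _))

/-- `B̃₂⁽²⁾` is translation invariant. [folklore] -/
theorem pkTI_kB2twoW (b c : ℝ) : PkTI (kB2twoW d b c) := by
  intro e p q
  unfold kB2twoW
  by_cases h : p.2 = q.1
  · rw [if_pos (show p.2 + e = q.1 + e by rw [h]), if_pos h, tsum_shift _ e]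
    congr 1
    refine tsum_congr fun a => ?_
    simp only [add_sub_add_right_eq_sub]
  · rw [if_neg (fun h' => h (add_right_cancel h')), if_neg h]

/-- `B̃₂` is translation invariant. [folklore] -/
theorem pkTI_kB2W (b c : ℝ) : PkTI (kB2W d b c) := fun e p q => by
  simp only [kB2W, pkTI_kB2oneW b c e p q, pkTI_kB2twoW b c e p q]

/-- **The lines out of the origin as a kernel from the pair `(0,0)`**: `A₃(0,u,w) = τ(w-0) τ(u-0) τ(w-u)
= (P_{τ,τ} ρ)((0,0),(w,u))`, and its weighted version `P_{G^{(b)},G^{(c)}} ρ` (weight `|·|^b` on the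
line `0 → w₀`, `|·|^c` on `0 → u₀`). [cite: HeydenreichVanDerHofstad2017, (7.4.2) and (7.5.5)]
[cite: Hara2008, §3.4 (Step 1)] -/
def kStartW (d : ℕ) (b c : ℝ) : Site d × Site d → Site d × Site d → ℝ≥0∞ := kRungR (kProp (gE d b) (gE d c))

/-- `Ψ^{(0)}(w,u) = (P_{τ,τ}ρ)((0,0),(w,u))`. [cite: HeydenreichVanDerHofstad2017, (7.5.5)] -/
theorem kPsiZero_eq_kStartW (p : Site d × Site d) : kPsiZero d p = kStartW d 0 0 (0, 0) p := by
  show percA3 d 0 p.2 p.1 = _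
  simp only [kStartW, kRungR, kProp, percA3_eq, gE_zero_exp, sub_zero, tauPcE_sub_comm p.1 p.2]

/-- **The lines into the endpoint as a kernel into the pair `(x,x)`**: `A₃(z,t,x) = τ(t-z) τ(x-z) τ(x-t)
= (ρ P_{τ,τ})((z,t),(x,x))`, weighted version `ρ P_{G^{(b)},G^{(c)}}` (weight `|·|^b` on `z → x`, `|·|^c`
on `t → x`). [cite: HeydenreichVanDerHofstad2017, (7.4.2) and (7.4.10)] [cite: Hara2008, §3.4 (Step 1)] -/
def kEndW (d : ℕ) (b c : ℝ) : Site d × Site d → Site d × Site d → ℝ≥0∞ := kRungL (kProp (gE d b) (gE d c))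

/-- `A₃(z,t,x) = (ρ P_{τ,τ})((z,t),(x,x))`. [cite: HeydenreichVanDerHofstad2017, (7.4.10)] -/
theorem kA3end_eq_kEndW (p : Site d × Site d) (x : Site d) : kA3end d p x = kEndW d 0 0 p (x, x) := by
  simp only [kA3end, kEndW, kRungL, kProp, percA3_eq, gE_zero_exp]
  ring

/-- The point mass at the pair `(0,0)` (start of every chain). [folklore] -/
def vDelta (d : ℕ) (p : Site d × Site d) : ℝ≥0∞ := if p = (0, 0) then 1 else 0

/-- `Σ_p δ_{(0,0)}(p) = 1`. [folklore] -/
theorem tsum_vDelta : ∑' p : Site d × Site d, vDelta d p = 1 := by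
  rw [tsum_eq_single ((0 : Site d), (0 : Site d))]
  · simp [vDelta]
  · intro p hp; simp [vDelta, hp]

/-- The indicator of the diagonal `{(x,x)}` (end of every chain after summing over `x`). [folklore] -/
def eDiag (d : ℕ) (p : Site d × Site d) : ℝ≥0∞ := if p.1 = p.2 then 1 else 0

/-- The diagonal indicator is translation invariant. [folklore] -/
theorem pvTI_eDiag : PvTI (eDiag d) := by
  intro c p
  simp only [eDiag, add_left_inj]

/-- `Σ_a δ_{diag}(0,a) = 1`. [folklore] -/
theorem tsum_eDiag_zero : ∑' a : Site d, eDiag d (0, a) = 1 := by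
  rw [tsum_eq_single (0 : Site d)]
  · simp [eDiag]
  · intro a ha; simp [eDiag, Ne.symm ha]

/-- Chains from the point mass: `Σ_p (δ_{(0,0)} X)(p) … ` picks the row `X((0,0), ·)`. [folklore] -/
theorem pkVmul_vDelta (X : Site d × Site d → Site d × Site d → ℝ≥0∞) (q : Site d × Site d) :
    pkVmul (vDelta d) X q = X (0, 0) q := by
  rw [pkVmul, tsum_eq_single ((0 : Site d), (0 : Site d))]
  · simp [vDelta]
  · intro p hp; simp [vDelta, hp]

/-- **The mixed norm of the (weighted) start/end propagator with its rung**: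
`‖P_{G^{(b)},G^{(c)}} ρ‖_mix, ‖ρ P_{G^{(b)},G^{(c)}}‖_mix ≤ W̄^{(b,c)}` (`τ ≤ 1` on the rung).
[cite: Hara2008, §3.4 (Step 2, case (b-2))] -/
theorem pkNormMix_kStartW_le (b c : ℝ) : pkNormMix (kStartW d b c) ≤ haraWBar d b c := by
  refine le_trans (iSup_mono fun q => ENNReal.tsum_le_tsum fun u => ?_)
    ((pkNormMix_kProp_le _ _ (gE_neg c)).trans (le_of_eq (haraWBar_eq_wForm b c).symm))
  exact mul_le_of_le_one_right zero_le (ENNReal.ofReal_le_one.2 (tau_le_one _ _ _))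

/-- `‖ρ P_{G^{(b)},G^{(c)}}‖_mix ≤ W̄^{(b,c)}`. [cite: Hara2008, §3.4 (Step 2, case (b-2))] -/
theorem pkNormMix_kEndW_le (b c : ℝ) : pkNormMix (kEndW d b c) ≤ haraWBar d b c := by
  refine le_trans (iSup_mono fun q => ENNReal.tsum_le_tsum fun u => ?_)
    ((pkNormMix_kProp_le _ _ (gE_neg c)).trans (le_of_eq (haraWBar_eq_wForm b c).symm))
  exact mul_le_of_le_one_left zero_le (ENNReal.ofReal_le_one.2 (tau_le_one _ _ _))

/-- **The start propagator with its rung in `‖·‖_{∞→∞}` is a `T`-form**: `‖P_{G^{(b)},G^{(c)}} ρ‖_{∞→∞}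
≤ T̄^{(b,c)}` (for `b = c = 0`: `Σ_{w,u} A₃(0,w,u) ≤ Δ_p`, (7.5.10)). [cite: HeydenreichVanDerHofstad2017, (7.5.10)]
[cite: Hara2008, §3.4 (Step 2)] -/
theorem pkNormInf_kStartW_le (b c : ℝ) : pkNormInf (kStartW d b c) ≤ haraTBar d b c := by
  rw [kStartW, haraTBar_eq_tForm]
  exact pkNormInf_kRungR_kProp_le _ _ (gE_neg c)

/-- **The end propagator with its rung in `‖·‖_{1→1}` is a `T`-form**: `‖ρ P_{G^{(b)},G^{(c)}}‖_{1→1} ≤ T̄^{(b,c)}`.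
[cite: Hara2008, §3.4 (Step 2)] -/
theorem pkNormOne_kEndW_le (b c : ℝ) : pkNormOne (kEndW d b c) ≤ haraTBar d b c := by
  rw [kEndW, haraTBar_eq_tForm]
  exact pkNormOne_kRungL_kProp_le _ _ (gE_neg b)

/-- The start propagator is translation invariant. [folklore] -/
theorem pkTI_kStartW (b c : ℝ) : PkTI (kStartW d b c) := pkTI_kRungR (pkTI_kProp _ _)

/-- The end propagator is translation invariant. [folklore] -/
theorem pkTI_kEndW (b c : ℝ) : PkTI (kEndW d b c) := pkTI_kRungL (pkTI_kProp _ _)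

/-- **The diagram of `Π^{(N+1)}` summed against a weight in `x`, as a chain from `δ_{(0,0)}` to the
diagonal**: `Σ_x F(x) [diagram](x) = Σ_p (δ_{(0,0)} · A₃-start · B₁B₂⋯B₁ · A₃-end)(p) δ_diag(p) F(p.1)`.
[cite: HeydenreichVanDerHofstad2017, (7.4.10)] -/
theorem tsum_mul_piNDiagramPc_succ_eq (n : ℕ) (F : Site d → ℝ≥0∞) :
    ∑' x : Site d, F x * piNDiagramPc d (n + 1) x =
      ∑' p : Site d × Site d, pkChainL (vDelta d) (kStartW d 0 0 :: (kFine d n ++ [kEndW d 0 0])) p *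
        (eDiag d p * F p.1) := by
  -- right-hand side: peel the start kernel and the end kernel
  have hstart : pkVmul (vDelta d) (kStartW d 0 0) = kPsiZero d := by
    funext q; rw [pkVmul_vDelta, kPsiZero_eq_kStartW]
  rw [pkChainL_cons, pkChainL_append, pkChainL_cons, pkChainL_nil, tsum_pkVmul_mul, hstart]
  -- the end: `Σ_x F x [diagram](x) = Σ_p Ψ-chain(p) Σ_q A₃end(p, q) diag(q) F(q.1)`
  calc ∑' x : Site d, F x * piNDiagramPc d (n + 1) x
      = ∑' x : Site d, F x * ∑' p : Site d × Site d, pkChainL (kPsiZero d) (kFine d n) p * kA3end d p x := by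
        refine tsum_congr fun x => ?_
        rw [piNDiagramPc_succ_eq_tsum_fineChain]
    _ = ∑' p : Site d × Site d, pkChainL (kPsiZero d) (kFine d n) p * ∑' x : Site d, kA3end d p x * F x := by
        calc ∑' x : Site d, F x * ∑' p : Site d × Site d, pkChainL (kPsiZero d) (kFine d n) p * kA3end d p x
            = ∑' x : Site d, ∑' p : Site d × Site d, pkChainL (kPsiZero d) (kFine d n) p * (kA3end d p x * F x) := by
              refine tsum_congr fun x => ?_
              rw [← ENNReal.tsum_mul_left]
              exact tsum_congr fun p => by ring
          _ = _ := by
              rw [ENNReal.tsum_comm]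
              exact tsum_congr fun p => ENNReal.tsum_mul_left
    _ = ∑' p : Site d × Site d, pkChainL (kPsiZero d) (kFine d n) p *
          pkKvec (kEndW d 0 0) (fun q => eDiag d q * F q.1) p := by
        refine tsum_congr fun p => ?_
        congr 1
        rw [pkKvec, ENNReal.tsum_prod']
        refine tsum_congr fun x => ?_
        rw [tsum_eq_single x]
        · simp only [eDiag, if_true, kA3end_eq_kEndW]
          ring
        · intro y hy
          simp [eDiag, Ne.symm hy]

end MorePieces

end Literature.Barriers.CriticalPhenomena
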